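import Literature.MathematicalPhysics.QuantumFieldTheory.Balaban1983to89.Beta.TransferUV
import Literature.MathematicalPhysics.QuantumFieldTheory.King1986.EffectiveLaplacianRate

/-!
# `Balaban1983to89.Beta.BulkParametrix` — β sub-cell row BETA-an5 (gen 2; v1.1–v1.2 gen 3, §5–§8; v1.3 gen 17 locator docfix): the `U = 1` bulk propagator as an EXACT
Sherman–Morrison/Woodbury perturbation of the free lattice propagator, and the η-UNIFORM lattice sums that make the
correction a parametrix remainder (the elementary half of BETA-SPEC §8.5 (H1-par) at the trivial background)

HONEST FRAMING (cell rule, verbatim): discharging `BetaPertH` makes Bałaban's UV stability UNCONDITIONAL — a real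
constructive-QFT result; it is NOT the continuum limit and NOT the Clay problem.  THIS MODULE DISCHARGES NOTHING of the
series: it is finite-dimensional linear algebra over `ℂ` and finite sums over boxes of `ℤ⁴`.  It asserts NO statement of
Bałaban's papers; every analytic input below is a HYPOTHESIS SHAPE with its printed locus named.  Value = kernel bricks
for the one open analytic statement (M2⁺) of the β sub-cell (one-loop positivity uniform in the scale), on the
bounded-oscillation road (MB) of `Beta.Transfer` / `Beta.TransferUV`, NOT summit progress (audit cell `pub-balaban`,
β sub-cell row BETA-an5 = "inf_k β̄_k > 0 and assembly", unit `b2b-balaban-beta-an5` gen 2; prose companion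
`run/shared/lean/pub/pub-balaban/BETA/AN5.md`).

WHY THIS IS ROW an5's ANALYSIS.  The row's instruction reads: «from an1/an2/an3's coefficient prove the uniform positive
lower bound (lattice-momentum sums bounded below uniformly in k — a concrete estimate on explicit lattice Green's-function
sums)».  The cell's reduction (BETA-SPEC v1.6 §8.5, `Beta.TransferUV`) locates the k-uniformity in ONE place: the bulk
propagator of the k-fold averaged theory at the trivial background must be the FREE lattice propagator plus a remainder
whose mixed gradients are bounded uniformly in `η = L^{−k}` ((H1-par)); then every one-loop term containing a remainder
factor is `O(1)` uniformly in `k` by absolute convergence, and the `k·log L` coefficient is that of the free,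
translation-invariant lattice vacuum polarisation (the printed computations' object, (H1-val), row an3).  This file
supplies (H1-par)'s ALGEBRA exactly and its LATTICE SUMS with explicit constants, for the componentwise ("transverse")
part of the `U = 1` propagator; the longitudinal rank-one term and the two-derivatives-on-one-leg face logarithm are
LOCATED (end of this header), not treated.

CITATION HEADER (lean-in-tree rule 2026-08-18) — sources and what is taken from each (nothing is asserted of them):
(B5) T. Bałaban, *Propagators and renormalization transformations for lattice gauge theories. I*, Commun. Math. Phys.
**95**, 17–40 (1984) [Balaban1984PropagatorsI]: p. 31–33, the momentum representation (1.83) of `G = Δ_a⁻¹`,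
`Δ_a = Δ − ∂P∂* + aQ*Q` at `U = 1`, with (1.84) `φ_μ(p′) = 1 + a Σ_{l″} |u(p′+l″)|² |v_μ(p′+l″)|² / Δ(p′+l″)` and the
sentence (p. 32, verbatim) «Let us notice at first that the function (1.85) … has a limit as p′ → 0, … and it is bounded
from below and above by positve [sic] constants independent of k and depending on d and a only.»  The cell's census of
(1.83) (unit b05-g2, `HOME/b2b-balaban-b05-g2/Prop11-census.md` §0, GAPS C-B5-4b; kernel leaves
`…Balaban1983to89.B5Prop11Leaves`) transcribes the fibre operator as `G(p′) = ⊕_μ O^{(μ)} + T₃`,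
`O^{(μ)}_{ll′} = δ_{ll′}/Δ(l) − a φ_μ⁻¹ x_μ(l) x̄_μ(l′)`, `x_μ(l) = conj(u(l)v_μ(l))/Δ(l)`, `T₃ = a⁻¹Φ⁻¹|b⟩⟨b|` (rank one
per fibre, `‖b‖ = O(Δ₀^{3/2})`).  THIS FILE's §1 certifies, abstractly, that a matrix of the displayed shape `O^{(μ)}`
IS the inverse of `diag Δ + a·w̄ ⊗ w` (`w = u·v_μ`): the componentwise part of the `U = 1` bulk propagator is EXACTLY
the free propagator corrected by a rank-one-per-fibre (Woodbury) term — the soft conditioning of the free field on its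
block averages.  (B9) T. Bałaban, Commun. Math. Phys. **99**, 389–434 (1985) [Balaban1985BackgroundPropagators]: (3.122)
p. 420 «G⁻¹ = Δ_π + DRD* + Q*aQ» and (3.130) (`G = G₀` at `U = 1`) — fixes that (B5)'s `G` is the `U = 1` value of the
background propagator entering the one-loop functional (BETA-SPEC §8.5; AN1.md Table T).  (K) C. King, Commun. Math.
Phys. **102**, 649–677 (1986) [King1986]: (4.5) p. 670 `Δ^{(k)}(p′) = (a_k⁻¹ + Σ_l |u_k^η(p′+l)|² Δ^η(p′+l)⁻¹)⁻¹` and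
Prop. 3.10 p. 669 «|Δ^{(k)}(p)| ≤ C uniformly in k» — the Woodbury middle factor IS King's effective Laplacian (tree:
`King1986.effSymbol`, `effSymbol_le`), for site averaging; (B5)'s bond averaging inserts the
factor `|v_μ|² ≤ 1` (`B5Prop11Leaves.uFactorr_le_one`).  (B4) T. Bałaban, Commun. Math. Phys. **89**, 571–597 (1983)
[Balaban1983RegularityDecay]: Lemma 2.4 (2.35)–(2.37) p. 582 (exponential decay of the unit-lattice kernels, uniform in
`j`; tree `…B4.Lemma24Printed`, supplement `…B4Strip`).  (LL) G. F. Lawler, V. Limic, *Random Walk: A Modern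
Introduction*, CUP 2010 [LawlerLimic2010], Thm. 4.3.1 (`G(x) = C_d|x|^{2−d} + O(|x|^{−d})`, `d ≥ 3`) — IN THE TREE as
`Literature.Probability.LatticeModels.latticeGreen_asymptotics` (kernel theorem, unit-free); and (L91) G. F. Lawler,
*Intersections of Random Walks*, Birkhäuser 1991 [Lawler1991], Thm. 1.5.5 (1.36) (verbatim): «If d ≥ 3, y ∈ Z^d,
y = |y|u, ∇_y G(x) − a_d |y| D_u(|x|^{2−d}) = O(|x|^{−d})» — since `D_u(|x|^{2−d}) = O(|x|^{1−d})`, the gradient form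
`|G(x+e) − G(x)| ≤ K′|x|^{1−d}` used in §2 is this printed theorem (and an elementary corollary of the tree's asymptotics:
mean values of `t^{2−d}` between `|x| − 1` and `|x| + 1`); it is carried here as the hypothesis SHAPE
`GreenGradientBound` with that citation (v1 does not re-derive it in the kernel).

WHAT IS KERNEL-CHECKED HERE (0 sorry, Mathlib + `Beta.TransferUV` only):
* §1 `shermanMorrison_entry` — for `D : Λ → ℂ` nonvanishing, `w : Λ → ℂ`, `a : ℂ` with
  `φ := 1 + a Σ_m |w m|²/D m ≠ 0`, the kernel `O_{ll′} = δ_{ll′}/D(l) − a φ⁻¹ (w̄(l)/D(l)) (w(l′)/D(l′))` satisfies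
  `Σ_{l′} O_{ll′} (D(l′)δ_{l′l″} + a w̄(l′) w(l″)) = δ_{ll″}` — i.e. (B5) (1.83)'s `O^{(μ)}` is `(diag Δ + aQ_μ*Q_μ)⁻¹`
  on each fibre, the Woodbury form `C − C Q*(a⁻¹ + QCQ*)⁻¹ Q C` of «free propagator + averaging term»; and
  `woodbury_effSymbol`: its middle factor `a/φ` is King's `effSymbol` (so «≤ a», `effSymbol_le`, is the k-uniform bound).
* §2 `abs_sum_le_of_cubic` — in `d = 4`, a kernel on the punctured sup-norm box of radius `M` bounded shellwise by
  `A·r⁻³` (an INTEGRABLE singularity: the gradient of the free propagator in physical units, `|∇C_η(w)| ≲ |w|⁻³`) has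
  sum `≤ 80·A·M`; with the fine-lattice measure `η⁴` and `η·M = 1` this is `blockSum_gradFree_le`: the sum over a unit
  block of fine points of `η⁴·|∇C_η|` is `≤ (80 K′ + K₀)·(normalisation)` UNIFORMLY IN `η = L^{−k}` — the «lattice
  Green's-function sums bounded uniformly in k» of the row's instruction, for the sum that controls (H1-par);
  `euclid_ge_of_mem_shell`: on the shell of sup-radius `r+1` the Euclidean norm is `≥ r+1` (so (LL)-type Euclidean bounds
  feed the sup-norm shell engine of `Beta.TransferUV`).
* §3 `abs_sum_sum_mul_mul_le` — the ℓ¹ ∘ ℓ¹ ∘ ℓ^∞ composition bound for a three-factor kernel `Σ_{y,y′} A(y)K(y,y′)B(y′)`;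
  and THE TYPED ESTIMATE `ParametrixRemainderBound`: for the Woodbury remainder with ONE derivative per leg,
  `(∇R∇′)(z,z′) = −Σ_{y,y′} (∇CQ*)(z,y)·K_eff(y,y′)·(QC∇′)(y′,z′)`, the inputs (I1) `Σ_y |(∇CQ*)(z,y)| ≤ α` (from §2 and
  `GreenGradientBound`, with the unit-scale decay of the block sums), (I2) `Σ_{y′} |K_eff(y,y′)| ≤ κ` ((K) Prop. 3.10 /
  (B4) Lemma 2.4 type: bounded, exponentially decaying unit-lattice kernel, uniform in k), (I3) `|(QC∇′)(y′,z′)| ≤ β`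
  give `|(∇R∇′)(z,z′)| ≤ α κ β` for EVERY `η` (`parametrixRemainder_le`) — the constant is explicit in the three inputs and
  nothing else depends on `k`.
* §4 non-vacuity of the hypothesis shapes on a one-point lattice (`Witness`).
* §5 (v1.1) THE CANCELLATION FORM — `sum_mul_eq_sum_mul_sub_of_cancel` / `_add_defect`, the row bounds
  `abs_sum_mul_le_defect` / `abs_sum_mul_le_of_cancel`, the hypothesis shapes `WeightedInputs` ⊂ `ParametrixInputsW`
  (cancel / weighted first moment of `K_eff` / weighted-Lipschitz leg / Peetre weight / WEIGHTED block sum), and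
  `parametrixRemainder_le_defect : WeightedInputs … → |(∇R∇′)(z,z′)| ≤ α_W κ₁ β₁ + Σ_y |(∇CQ*)(z,y)|·|Σ_{y′}K_eff(y,y′)|·
  |(QC∇′)(y,z′)|` (row-sum defect; zero under `cancel`, → 0 for truncations `Y_N ↗ ℤ⁴`),
  `parametrixRemainder_le_cancel : ParametrixInputsW … α_W κ₁ β₁ → |(∇R∇′)(z,z′)| ≤ α_W κ₁ β₁` (+ `_uniform` in `k`);
  and the symbol-level certificate of the mechanism `effSymbol_le_zeroAlias` (King's
  `Δ^{(k)}(p′) ≤ Δ^η(p′+l₀)/|u(p′+l₀)|²`: the effective Laplacian vanishes at zero momentum like the massless free one,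
  i.e. `K_eff` annihilates constants — the upper half of (B5)'s statement on (1.85)).
* §6 (v1.1) the dictionary instances are VOLUME-FREE: `peetre_of_triangle`; `pow_mul_pow_le_add`;
  `sum_inv_pow_le_of_shellCount` (`Σ_y (1+ℓ(y))⁻ⁿ ≤ S₀ + 2S` for `n ≥ 5` from shell counts `#{ℓ = 0} ≤ S₀`,
  `#{ℓ = r+1} ≤ S(r+1)³` — `S₀ = 1, S = 80` on `ℤ⁴`, any finite volume); `weightedPair_sum_le`
  (`Σ_y (1+ℓ)^{−p}(1+ℓ′)^{−q} ≤ 2(S₀+2S)` for `p + q ≥ 5`: `(3,4)` for `∇R∇′`, `(2,3)/(3,3)/(2,4)` for `R, ∇R, R∇′`);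
  `blockSumsW_of_decay`; and for unit sites embedded in `ℤ⁴` (`e : Y ↪ ℤ⁴`, the `T ↗ ℤ⁴` object of (B12) p. 264) the
  shell counts themselves: `supNorm`, `mem_box_iff_supNorm_le`, `shellCount_of_embedding`, `zeroCount_of_embedding`,
  `weightedPair_sum_le_of_embedding` (`≤ 322` for ANY finite set of sites, ANY two centres, any `p + q ≥ 5`).
* §7 (v1.1) non-vacuity of `ParametrixInputsW` (two sites, `K_eff = [[1,−1],[−1,1]]`, remainder `0 ≤ 4`) and of the
  shell counts.
* §8 (v1.2) THE TWO-LEG ABSOLUTE BOUND — `abs_sum_sum_mul_mul_le_twoLeg`, hypothesis shape `TwoLegInputs` (legA / legB decay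
  profiles, Peetre transport of the second leg's weight across `K_eff`, a row-MOMENT of `K_eff`, the PAIR sum of the two
  profiles), `parametrixRemainder_le_twoLeg(_uniform) : TwoLegInputs … α₀ β₀ κ Λ → |(∇R∇′)| ≤ α₀β₀κΛ`; on `ℤ⁴`:
  `supNorm_sub_le` (triangle inequality), `peetre_supNorm`, and the packaged `parametrixRemainder_le_of_embedding`:
  legs `≲ (1+dist)^{−p}`, `(1+dist)^{−q}` with `p + q ≥ 5` and a `q`-th row-moment `κ` of `K_eff` ⟹ `|(∇R∇′)(z,z′)| ≤
  322·α₀β₀κ` for ANY finite set of unit sites and ANY `z, z′` — NO cancellation, NO single-leg sum.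

v1.3 (2026-08-19, b2b-balaban-beta-an5 gen 17) — LOCATOR DOCFIX ONLY (t4-lit1 citation police PASS 4, finding P-t4lit1g6-5,
journal NOTE 2026-08-19T20:06:26Z; page re-read on the render `…1984-cmp95-propagators-rt-I-p015-x2.png`): (B5) (1.82), (1.83)
AND (1.84) are all printed on p. 31 (PDF 15; (1.84) `φ_μ(p′) = 1 + aΣ_{l″}|u(p′+l″)|²|v_μ(p′+l″)|²/Δ(p′+l″) for p′ ≠ 0` closes
the page); p. 32 opens «We will prove that G is a bounded operator …» and carries (1.85)–(1.88).  Two tags corrected: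
`phi` «(1.84) p.32» → «(1.84) p.31», `avgOp` «(1.82)–(1.84) pp.31–32» → «(1.82)–(1.84) p.31»; the (1.85) p. 32 tags were right.
No declaration, statement or proof changed.

v1.2 ADDENDUM — CORRECTION OF EMPHASIS (this seat, same session as v1.1).  For the DIFFERENTIATED remainders the volume-free,
k-uniform BOUNDEDNESS needs NO cancellation: the two block-averaged legs decay like `dist⁻³` (resp. `dist⁻²` for an
undifferentiated leg) from their own endpoints, and `3 + 3 = 6`, `3 + 2 = 5` exceed `d = 4`, so the DOUBLY-weighted block
sum `Σ_y (1+dist(z,y))^{−p}(1+dist(y,z′))^{−q}` converges (§6, `≤ 322`) once the second leg's weight is transported across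
the exponentially localised `K_eff` by Peetre at the price of a `q`-th row-moment (§8).  What G-adv2-23 (b) refutes is
exactly v1's FACTORISATION (I1′)·(I2)·(I3), which sums ONE leg absolutely and discards the other's decay — RULING (R3)(i)
stands as stated (that instantiation is barred).  The CANCELLATION FORM of §5 (RULING (R3)(ii)) is TRUE AS WELL, gives one
power more (total `p + q + 1`), and is NECESSARY exactly where the two-leg count is critical: the UNDIFFERENTIATED
remainder `R` (`2 + 2 = 4 = d`, logarithmic in the volume without the cancellation; with it `(2,3)`), which enters the
one-loop coefficient through the tadpole / `G·∇∇′G`-type terms; it is also what fixes the long-range SIZE `R ≈ C`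
(`K̂_eff(0) = 0`).  So the (AF-0-L) slot `A₁` at `U = 1`, componentwise, is served by §8 for `∇R∇′`, `∇R`, `R∇′` and by
§5 for `R`; the printed-TYPE inputs are, respectively, a row-moment of `K_eff` and (for §5) additionally `cancel` +
the second-difference SHAPE of the free leg.  Nothing of v1.1 is withdrawn; its sentence «the finiteness mechanism is
instead a CANCELLATION» is to be read with this qualification.

v1.1 ADDENDUM — WHY THE CANCELLATION FORM (GAPS G-adv2-23 / C-adv2-15, adversarial reader adv2-g11; lead RULING (R3),
BETA-SPEC v1.8b §8.6(l)).  The v1 input (I1′) `Σ_y |(∇CQ*)(z,y)| ≤ α` is correct algebra but is NOT INSTANTIABLE for the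
massless leg on `ℤ⁴`: `|(∇CQ*)(z,y)| ≍ |z−y|⁻³`, so `Σ_{|y−z|≤N} ≍ N`; and the β-function of (B12) (1.22) is the
`T^{(j+1)} ↗ ℤ^d` limit (p. 264 «This limit exists by the localized representation (1.7)»), so a constant `α = α(N)`
proves nothing toward it (RULING (R3)(i)).  The v1 docstring's escape «summable by the decay of a μ-regularised
kernel» is WITHDRAWN (a mass term breaks the exactness of the Woodbury identity §1).  The finiteness mechanism is
instead a CANCELLATION, printed at (B5) p. 32: (1.85) `Δ(p′)φ_μ(p′)` is two-sided bounded, so the middle factor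
`a φ_μ⁻¹ ≍ Δ(p′) → 0` at `p′ = 0` — `K_eff` ANNIHILATES CONSTANTS (`effSymbol_le_zeroAlias` is the kernel form of the
upper half).  Then `Σ_{y′} K_eff(y,y′)(QC∇′)(y′,z′) = Σ_{y′} K_eff(y,y′)[(QC∇′)(y′,z′) − (QC∇′)(y,z′)]`, the
difference decays ONE POWER FASTER (`≲ dist(y,y′)·(1+dist(y,z′))⁻⁴` up to the Peetre factor, (L91) (1.36)), and the
remaining block sum `Σ_y |z−y|⁻³(1+|y−z′|)⁻⁴` CONVERGES on `ℤ⁴` with a constant free of the volume and of `z, z′`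
(§6, `≤ 322` per unit of the decay constants; total decay `3 + 4 > d = 4`).  §5 types exactly this: NO absolute block
sum of the massless leg and NO absolute row sum of `K_eff` is ever formed; the DEFECT form covers finite truncations,
whose boundary rows do not cancel, and passes to `ℤ⁴` by absolute convergence.  WHERE IT IS USED (AN5.md v1.3 §2):
the (AF-0-L) road (BETA-SPEC §8.6(m), `Beta.LargeLWindow.WindowDecomposition`) needs the remainder ONLY LOCALLY
(`|z − z′| ≤ 1` block, the slot `A₁`: `Σ_{|w|≤1} η⁴ w²(Π_G − Π_C)(w)` with `|Π_G − Π_C| ≤ |∇C||∇R| + …`, an integrable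
singularity `|w|⁻¹` once `∇R`-type kernels are BOUNDED η-uniformly and volume-free — this file), the far region
`|w| > 1` being the printed exponential decay of the FULL `G_k` ((B4) Lemma 2.4 / (B5)), and the window `M < |x| ≤ LM`
of the FREE unit-lattice bubble giving `b₀ log L` (`Beta.DyadicShell`); DECAY of `∇R∇′` in `|z − z′|` is therefore not
needed and not claimed.  What stays PROSE: the instantiation of `lipschitzW` for the blocks adjacent to `z′` (trivial
bound `2β` of v1 §2, same shape), the exponential decay of `K_eff` uniform in `k` giving `moment` (printed TYPE (K)
Prop. 3.10 / (B4) Lemma 2.4), the longitudinal term `T₃` (same three-factor shape, middle factor `a⁻¹Φ⁻¹` with the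
(1.86) bound; its cancellation structure is C-adv2-15 P3, OPEN in prose), the legs with fewer derivatives (same
theorems, exponents `(2,3)`, `(3,3)`), and everything at `U ≠ 1` ((H1-par) proper, rows an1/an2).  Value = the typed,
instantiable estimate replacing an uninstantiable one; NOT a discharge of (H1-par), NOT summit progress.

LOCATED, NOT TREATED (prose, AN5.md §3): (i) the longitudinal term `T₃` of (1.83) (from `−∂P∂*`; rank one per fibre,
`‖b‖ = O(Δ₀^{3/2})`, UV tail carrying `u(l)`) has the same «fine ∘ Q* ∘ unit ∘ Q ∘ fine» shape and falls under §3 once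
its unit-lattice factor is bounded ((B5) (1.86), tree `B5Prop11Leaves.ineq186`); (ii) TWO derivatives on ONE leg of
`CQ*` produce `∫_{block} |z−x|⁻⁴ dx ~ log(1/dist(z, ∂block))`, integrable over the block (`∫₀¹ log(1/s) ds = 1`): this
is BETA-SPEC §8.5 (H1-face) (row an1), an `O(1)` per unit volume, not a `log(1/η)`; (iii) the background (`U ≠ 1`)
version and the `B`-derivatives of all of the above (rows an1/an2: analyticity in the background, Cauchy estimates) —
(H1-par) proper.  With (i)–(iii) the accumulated `U = 1` bulk one-loop F²-coefficient splits as «free translation-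
invariant lattice vacuum polarisation» + `O(1)` uniformly in `k` (`Beta.TransferUV.coeff_of_close`), which is the
precise sense in which (H1-val) — the SIGN and VALUE of the log-coefficient, the heart — is a statement about standard
lattice Feynman integrals (row an3, G-beta-an3-4).  None of (i)–(iii), (H1-val), (H1-W), (H2) is claimed here.
-/

namespace Literature.MathematicalPhysics.QuantumFieldTheory.Balaban1983to89.Beta.BulkParametrix

open Literature.MathematicalPhysics.QuantumFieldTheory
open Literature.MathematicalPhysics.QuantumFieldTheory.Balaban1983to89
open Literature.Probability.LatticeModels (box mem_box annulus mem_annulus)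
open Beta.TransferUV
open Finset

/-! ## §1 — The fibre algebra of (B5) (1.83): the componentwise part is a Sherman–Morrison inverse -/

section ShermanMorrison

variable {Λ : Type*} [Fintype Λ] [DecidableEq Λ]

/-- The averaging denominator `φ = 1 + a Σ_m |w m|² / D m` ((B5) (1.84) with `w = u·v_μ`, `D = Δ`; King (4.5)'s
`a·(a⁻¹ + Σ|u|²/Δ)` ). [cite: Balaban1984PropagatorsI, (1.84) p.31] -/
noncomputable def phi (D : Λ → ℂ) (a : ℂ) (w : Λ → ℂ) : ℂ :=
  1 + a * ∑ m, (starRingEnd ℂ (w m) * w m) / D m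

/-- The displayed fibre kernel `O_{ll′} = δ_{ll′}/D(l) − a φ⁻¹ x(l) x̄(l′)`, `x(l) = w̄(l)/D(l)` — the shape of the
componentwise part `O^{(μ)}` of (B5) (1.83) (census C-B5-4b §0). [cite: Balaban1984PropagatorsI, (1.83) p.31] -/
noncomputable def smKernel (D : Λ → ℂ) (a : ℂ) (w : Λ → ℂ) (l l' : Λ) : ℂ :=
  (if l = l' then (D l)⁻¹ else 0) -
    a * (phi D a w)⁻¹ * (starRingEnd ℂ (w l) / D l) * (w l' / D l')

/-- The fibre operator «free inverse propagator + averaging term»: `M_{l′l″} = D(l′)δ_{l′l″} + a w̄(l′) w(l″)`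
(`diag Δ + a Q_μ*Q_μ` on the fibre over `p′`; the rank-one term is the block-averaging form `a|Q_μ A|²` read in
momentum space). [cite: Balaban1984PropagatorsI, (1.82)–(1.84) p.31] -/
noncomputable def avgOp (D : Λ → ℂ) (a : ℂ) (w : Λ → ℂ) (l' l'' : Λ) : ℂ :=
  (if l' = l'' then D l' else 0) + a * starRingEnd ℂ (w l') * w l''

/-- **SHERMAN–MORRISON, ENTRYWISE** (certifies the reading of (B5) (1.83)): if every `D(l) ≠ 0` and `φ ≠ 0`, then
`Σ_{l′} O_{ll′} M_{l′l″} = δ_{ll″}` — the displayed `O^{(μ)}` IS the inverse of `diag Δ + aQ_μ*Q_μ`, i.e. the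
componentwise `U = 1` bulk propagator is EXACTLY the free propagator `1/Δ(l)` corrected by the rank-one-per-fibre
Woodbury term `−a φ_μ⁻¹ x_μ x̄_μ` (position space: `C − CQ*(a⁻¹ + QCQ*)⁻¹QC`). [folklore] -/
theorem shermanMorrison_entry (D : Λ → ℂ) (a : ℂ) (w : Λ → ℂ) (hD : ∀ l, D l ≠ 0) (hφ : phi D a w ≠ 0)
    (l l'' : Λ) : ∑ l', smKernel D a w l l' * avgOp D a w l' l'' = if l = l'' then 1 else 0 := by
  -- abbreviations
  set φ : ℂ := phi D a w with hφdef
  set c : Λ → ℂ := fun m => starRingEnd ℂ (w m) with hc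
  set S : ℂ := ∑ m, (c m * w m) / D m with hS
  have hφS : φ = 1 + a * S := by simp [hφdef, phi, hS, hc]
  -- expand the product entrywise into four sums
  have expand : ∀ l', smKernel D a w l l' * avgOp D a w l' l'' =
      ((if l = l' then (D l)⁻¹ else 0) * (if l' = l'' then D l' else 0)) +
      ((if l = l' then (D l)⁻¹ else 0) * (a * c l' * w l'')) -
      (a * φ⁻¹ * (c l / D l) * (w l' / D l') * (if l' = l'' then D l' else 0)) -
      (a * φ⁻¹ * (c l / D l) * ((w l' / D l') * (a * c l' * w l''))) := by
    intro l'
    simp only [smKernel, avgOp, ← hφdef, hc]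
    ring
  rw [Finset.sum_congr rfl fun l' _ => expand l']
  simp only [Finset.sum_sub_distrib, Finset.sum_add_distrib]
  -- first sum: δ_{ll''}
  have h1 : ∑ l', (if l = l' then (D l)⁻¹ else 0) * (if l' = l'' then D l' else (0:ℂ)) =
      if l = l'' then 1 else 0 := by
    rw [Finset.sum_eq_single l]
    · by_cases h : l = l''
      · subst h; simp [inv_mul_cancel₀ (hD l)]
      · simp [h]
    · intro b _ hb; simp [Ne.symm hb]
    · intro h; exact absurd (Finset.mem_univ l) h
  -- second sum: a c_l w_{l''} / D_l
  have h2 : ∑ l', (if l = l' then (D l)⁻¹ else 0) * (a * c l' * w l'') = (D l)⁻¹ * (a * c l * w l'') := by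
    rw [Finset.sum_eq_single l]
    · simp
    · intro b _ hb; simp [Ne.symm hb]
    · intro h; exact absurd (Finset.mem_univ l) h
  -- third sum
  have h3 : ∑ l', a * φ⁻¹ * (c l / D l) * (w l' / D l') * (if l' = l'' then D l' else (0:ℂ)) =
      a * φ⁻¹ * (c l / D l) * w l'' := by
    rw [Finset.sum_eq_single l'']
    · simp only [if_true]
      rw [mul_assoc, div_mul_cancel₀ _ (hD l'')]
    · intro b _ hb; simp [hb]
    · intro h; exact absurd (Finset.mem_univ l'') h
  -- fourth sum
  have h4 : ∑ l', a * φ⁻¹ * (c l / D l) * ((w l' / D l') * (a * c l' * w l'')) =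
      a * φ⁻¹ * (c l / D l) * (a * S * w l'') := by
    rw [← Finset.mul_sum]
    congr 1
    rw [hS, Finset.mul_sum, Finset.sum_mul]
    refine Finset.sum_congr rfl fun m _ => ?_
    ring
  rw [h1, h2, h3, h4]
  -- the three correction terms cancel because φ = 1 + aS
  have key : (D l)⁻¹ * (a * c l * w l'') - a * φ⁻¹ * (c l / D l) * w l'' -
      a * φ⁻¹ * (c l / D l) * (a * S * w l'') = 0 := by
    have e : (D l)⁻¹ * (a * c l * w l'') = a * φ⁻¹ * (c l / D l) * (φ * w l'') := by
      field_simp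
    rw [e, hφS]
    ring
  have := key
  split_ifs with h
  · linear_combination key
  · linear_combination key

/-- The Woodbury middle factor `a·φ⁻¹ = (a⁻¹ + Σ_m |w m|²/D m)⁻¹` IS King's effective-Laplacian symbol
`King1986.effSymbol` (real data: `D > 0`, `a ≠ 0`, weights `|w|²`), so its k-UNIFORM bound is
the printed «Δ^{(k)} ≤ a_k» / «|Δ^{(k)}(p)| ≤ C uniformly in k» (`effSymbol_le`; King Prop. 3.10 (3.91) p.669).
[cite: King1986, (4.5) p.670 and Prop. 3.10 p.669] -/
theorem woodbury_effSymbol {ι : Type*} (s : Finset ι) (a : ℝ) (ha : a ≠ 0) (W A : ι → ℝ) :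
    a * (1 + a * ∑ i ∈ s, W i / A i)⁻¹ = King1986.effSymbol s a W A := by
  rw [King1986.effSymbol]
  have e : (1 + a * ∑ i ∈ s, W i / A i) = a * (a⁻¹ + ∑ i ∈ s, W i * (A i)⁻¹) := by
    rw [mul_add, mul_inv_cancel₀ ha]
    congr 1
  rw [e, mul_inv, ← mul_assoc, mul_inv_cancel₀ ha, one_mul]

end ShermanMorrison

/-! ## §2 — η-uniform lattice sums in `d = 4`: an integrable singularity summed over a block -/

/-- On the sup-norm shell of radius `r+1` (`annulus 4 r (r+1)`), the Euclidean norm is at least `r+1`: Euclidean decay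
bounds (the (LL) form `K·|x|^{−p}`) imply the shellwise bounds of the `Beta.TransferUV` engine. [folklore] -/
theorem euclid_ge_of_mem_shell {d r : ℕ} {z : Fin d → ℤ} (hz : z ∈ annulus d r (r + 1)) :
    (r : ℝ) + 1 ≤ Real.sqrt (∑ i, ((z i : ℤ) : ℝ) ^ 2) := by
  rw [mem_annulus] at hz
  obtain ⟨-, hnot⟩ := hz
  simp only [mem_box, not_forall, not_and, not_le] at hnot
  obtain ⟨i, hi⟩ := hnot
  have habs : (r : ℤ) + 1 ≤ |z i| := by
    rcases le_or_gt (-(r : ℤ)) (z i) with h | h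
    · have := hi h
      rw [abs_of_nonneg (by omega)]; omega
    · rw [abs_of_neg (by omega)]; omega
  have hsq : ((r : ℝ) + 1) ^ 2 ≤ ((z i : ℤ) : ℝ) ^ 2 := by
    have h' : ((r : ℝ) + 1) ≤ |((z i : ℤ) : ℝ)| := by exact_mod_cast habs
    calc ((r : ℝ) + 1) ^ 2 ≤ |((z i : ℤ) : ℝ)| ^ 2 := by gcongr
      _ = ((z i : ℤ) : ℝ) ^ 2 := sq_abs _
  have hle : ((z i : ℤ) : ℝ) ^ 2 ≤ ∑ j, ((z j : ℤ) : ℝ) ^ 2 :=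
    Finset.single_le_sum (fun j _ => sq_nonneg (((z j : ℤ) : ℝ))) (Finset.mem_univ i)
  calc (r : ℝ) + 1 = Real.sqrt (((r : ℝ) + 1) ^ 2) := by rw [Real.sqrt_sq (by positivity)]
    _ ≤ Real.sqrt (∑ j, ((z j : ℤ) : ℝ) ^ 2) := Real.sqrt_le_sqrt (hsq.trans hle)

/-- **AN INTEGRABLE SINGULARITY SUMS TO `O(M)`.**  In `d = 4`, if `|f z| ≤ A/(r+1)³` on the shell of sup-radius `r+1`
(the decay `|x|^{1−d}` of the GRADIENT of the free lattice Green function, (LL) Thm. 4.3.1), then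
`|Σ_{0<‖z‖_∞≤M} f z| ≤ 80·A·M`: one power LESS than marginal grows linearly in the box radius — in physical units
(`η⁴` per point, `ηM = 1`) a bounded quantity, `blockSum_le_of_cubic`. [folklore] -/
theorem abs_sum_le_of_cubic {M : ℕ} {f : (Fin 4 → ℤ) → ℝ} {A : ℝ} (hA : 0 ≤ A)
    (hf : ∀ r, ∀ z ∈ annulus 4 r (r + 1), |f z| ≤ A / ((r : ℝ) + 1) ^ 3) :
    |∑ z ∈ annulus 4 0 M, f z| ≤ 80 * A * M := by
  refine (abs_sum_annulus_zero_le hf).trans ?_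
  have hterm : ∀ r ∈ Finset.range M,
      ((annulus 4 r (r + 1)).card : ℝ) * (A / ((r : ℝ) + 1) ^ 3) ≤ 80 * A := by
    intro r _
    have hr : (0 : ℝ) < (r : ℝ) + 1 := by positivity
    calc ((annulus 4 r (r + 1)).card : ℝ) * (A / ((r : ℝ) + 1) ^ 3)
        ≤ 80 * ((r : ℝ) + 1) ^ 3 * (A / ((r : ℝ) + 1) ^ 3) :=
          mul_le_mul_of_nonneg_right (card_annulus_succ_four_le r) (by positivity)
      _ = 80 * A := by field_simp
  calc ∑ r ∈ Finset.range M, ((annulus 4 r (r + 1)).card : ℝ) * (A / ((r : ℝ) + 1) ^ 3)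
      ≤ ∑ r ∈ Finset.range M, (80 * A : ℝ) := Finset.sum_le_sum hterm
    _ = 80 * A * M := by rw [Finset.sum_const, Finset.card_range, nsmul_eq_mul]; ring

/-- **THE BLOCK SUM IS BOUNDED UNIFORMLY IN `η`.**  Physical normalisation: a unit block holds `M = η⁻¹` fine points
per direction, each of measure `η⁴`; a kernel `g` on fine points with `|g(ηz)| ≤ K′·(η‖z‖_∞)⁻³` off the origin
(`= K′ η⁻³ (r+1)⁻³` on the shell `r+1`) and `|g(0)| ≤ K₀ η⁻³` (the lattice value at coinciding points) has
`η⁴ Σ_{‖z‖_∞ ≤ M} |g| ≤ 80 K′ + K₀ η ≤ 80 K′ + K₀` — no `log(1/η)`, no power of `η⁻¹`.  Stated with `η = 1/M`: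
the two sums are `≤ 80K′` and `≤ K₀/M`. [folklore] -/
theorem blockSum_le_of_cubic {M : ℕ} (hM : 1 ≤ M) {g : (Fin 4 → ℤ) → ℝ} {K' K₀ : ℝ} (hK' : 0 ≤ K')
    (hoff : ∀ r, ∀ z ∈ annulus 4 r (r + 1), |g z| ≤ K' * (M : ℝ) ^ 3 / ((r : ℝ) + 1) ^ 3)
    (h0 : |g 0| ≤ K₀ * (M : ℝ) ^ 3) :
    (1 / (M : ℝ)) ^ 4 * (|g 0| + |∑ z ∈ annulus 4 0 M, g z|) ≤ K₀ / M + 80 * K' := by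
  have hMpos : (0 : ℝ) < M := by exact_mod_cast hM
  have hsum := abs_sum_le_of_cubic (M := M) (A := K' * (M : ℝ) ^ 3) (by positivity) hoff
  have e1 : (1 / (M : ℝ)) ^ 4 * |g 0| ≤ K₀ / M := by
    calc (1 / (M : ℝ)) ^ 4 * |g 0| ≤ (1 / (M : ℝ)) ^ 4 * (K₀ * (M : ℝ) ^ 3) :=
          mul_le_mul_of_nonneg_left h0 (by positivity)
      _ = K₀ / M := by field_simp
  have e2 : (1 / (M : ℝ)) ^ 4 * |∑ z ∈ annulus 4 0 M, g z| ≤ 80 * K' := by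
    calc (1 / (M : ℝ)) ^ 4 * |∑ z ∈ annulus 4 0 M, g z| ≤ (1 / (M : ℝ)) ^ 4 * (80 * (K' * (M : ℝ) ^ 3) * M) :=
          mul_le_mul_of_nonneg_left hsum (by positivity)
      _ = 80 * K' := by field_simp
  rw [mul_add]
  exact add_le_add e1 e2

/-- **HYPOTHESIS SHAPE (I1): GRADIENT BOUND OF THE FREE LATTICE GREEN FUNCTION** — `|G(x + e_i) − G(x)| ≤ K′·|x|^{1−d}`
(Euclidean norm) for `x ≠ 0`, `d ≥ 3`.  In print, verbatim: (L91) Thm. 1.5.5 (1.36) «If d ≥ 3, y ∈ Z^d, y = |y|u,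
∇_y G(x) − a_d |y| D_u(|x|^{2−d}) = O(|x|^{−d})» (`∇_y G(x) = G(x+y) − G(x)`, `D_u(|x|^{2−d}) = (2−d)|x|^{1−d}(x·u)/|x|`),
whence `|G(x+e_i) − G(x)| ≤ (a_d(d−2) + O(1))|x|^{1−d}`; also an elementary corollary of (LL) Thm. 4.3.1 = the tree's
`LatticeModels.latticeGreen_asymptotics` (compare `t^{2−d}` at `|x+e_i|` and `|x|`, `||x+e_i| − |x|| ≤ 1`).  This file
carries the SHAPE (free constant `K′`, any normalisation of `G`) and asserts it of nothing.
By scaling, the fine-lattice propagator `C_η(w) = η^{2−d}·G(w/η)/2` of `−Δ_η` on `ηℤ^d` then has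
`|∇_η C_η(w)| ≤ (K′/2)·|w|^{1−d}` in physical units, uniformly in `η` — the input of `blockSum_le_of_cubic` with `d = 4`.
[cite: Lawler1991, Thm. 1.5.5 (1.36)] -/
def GreenGradientBound (d : ℕ) (G : (Fin d → ℤ) → ℝ) (K' : ℝ) : Prop :=
  ∀ x : Fin d → ℤ, x ≠ 0 → ∀ i : Fin d,
    |G (x + Pi.single i 1) - G x| ≤ K' * Real.sqrt (∑ j, ((x j : ℤ) : ℝ) ^ 2) ^ (1 - (d : ℝ))

/-- From the (I1) shape in `d = 4` to the shellwise hypothesis of `abs_sum_le_of_cubic`: on the shell of sup-radius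
`r+1`, `K′·|z|⁻³ ≤ K′/(r+1)³`. [folklore] -/
theorem shell_bound_of_greenGradientBound {G : (Fin 4 → ℤ) → ℝ} {K' : ℝ} (hK' : 0 ≤ K') (h : GreenGradientBound 4 G K')
    (i : Fin 4) (r : ℕ) (z : Fin 4 → ℤ) (hz : z ∈ annulus 4 r (r + 1)) :
    |G (z + Pi.single i 1) - G z| ≤ K' / ((r : ℝ) + 1) ^ 3 := by
  have hz0 : z ≠ 0 := by
    rintro rfl
    have := euclid_ge_of_mem_shell hz
    simp at this
    linarith
  have hR := euclid_ge_of_mem_shell hz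
  have hr1 : (0 : ℝ) < (r : ℝ) + 1 := by positivity
  have hRpos : 0 < Real.sqrt (∑ j, ((z j : ℤ) : ℝ) ^ 2) := lt_of_lt_of_le hr1 hR
  refine (h z hz0 i).trans ?_
  have e : (1 - ((4 : ℕ) : ℝ)) = -(3 : ℝ) := by norm_num
  rw [e, Real.rpow_neg hRpos.le, show (3 : ℝ) = ((3 : ℕ) : ℝ) by norm_num, Real.rpow_natCast, div_eq_mul_inv]
  gcongr

/-! ## §3 — The Woodbury remainder with one derivative per leg: bounded uniformly in `k` from three inputs -/

section Composition

variable {Y : Type*} [Fintype Y]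

/-- **ℓ¹ ∘ ℓ¹ ∘ ℓ^∞ COMPOSITION.**  `|Σ_{y,y′} A(y) K(y,y′) B(y′)| ≤ α κ β` whenever `Σ_y |A y| ≤ α`,
`Σ_{y′} |K y y′| ≤ κ` for every `y`, and `|B y′| ≤ β` for every `y′`. [folklore] -/
theorem abs_sum_sum_mul_mul_le (A : Y → ℝ) (K : Y → Y → ℝ) (B : Y → ℝ) {α κ β : ℝ} (hκ : 0 ≤ κ) (hβ : 0 ≤ β)
    (hA : ∑ y, |A y| ≤ α) (hK : ∀ y, ∑ y', |K y y'| ≤ κ) (hB : ∀ y', |B y'| ≤ β) :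
    |∑ y, ∑ y', A y * K y y' * B y'| ≤ α * κ * β := by
  calc |∑ y, ∑ y', A y * K y y' * B y'|
      ≤ ∑ y, |∑ y', A y * K y y' * B y'| := Finset.abs_sum_le_sum_abs _ _
    _ ≤ ∑ y, ∑ y', |A y * K y y' * B y'| := Finset.sum_le_sum fun y _ => Finset.abs_sum_le_sum_abs _ _
    _ = ∑ y, |A y| * ∑ y', |K y y'| * |B y'| := by
        refine Finset.sum_congr rfl fun y _ => ?_
        rw [Finset.mul_sum]
        refine Finset.sum_congr rfl fun y' _ => ?_
        rw [abs_mul, abs_mul, mul_assoc]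
    _ ≤ ∑ y, |A y| * (κ * β) := by
        refine Finset.sum_le_sum fun y _ => mul_le_mul_of_nonneg_left ?_ (abs_nonneg _)
        calc ∑ y', |K y y'| * |B y'| ≤ ∑ y', |K y y'| * β :=
              Finset.sum_le_sum fun y' _ => mul_le_mul_of_nonneg_left (hB y') (abs_nonneg _)
          _ = (∑ y', |K y y'|) * β := by rw [Finset.sum_mul]
          _ ≤ κ * β := mul_le_mul_of_nonneg_right (hK y) hβ
    _ = (∑ y, |A y|) * (κ * β) := by rw [Finset.sum_mul]
    _ ≤ α * (κ * β) := mul_le_mul_of_nonneg_right hA (mul_nonneg hκ hβ)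
    _ = α * κ * β := by ring

/-- **THE WOODBURY REMAINDER, ONE DERIVATIVE PER LEG.**  Position-space form of §1 at fixed fine points `z, z′`: the
mixed gradient of the correction `R = G − C ⊗ 1 = −(CQ*)·K_eff·(QC)` is the three-factor unit-lattice sum
`(∇R∇′)(z,z′) = −Σ_{y,y′} (∇C Q*)(z,y) · K_eff(y,y′) · (Q C ∇′)(y′,z′)` (`K_eff = (a⁻¹ + QCQ*)⁻¹`, King's `Δ^{(k)}`
for the component in hand).  The data: `gradCQ z : Y → ℝ` (the block averages of `∇C(z − ·)`), `Keff : Y → Y → ℝ`,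
`QCgrad z′ : Y → ℝ`. [cite: Balaban1984PropagatorsI, (1.83) p.31; King1986, (4.5) p.670] -/
noncomputable def woodburyRemainder (gradCQ : Y → ℝ) (Keff : Y → Y → ℝ) (QCgrad : Y → ℝ) : ℝ :=
  -∑ y, ∑ y', gradCQ y * Keff y y' * QCgrad y'

/-- **HYPOTHESIS SHAPE — the three k-uniform inputs of (H1-par) at `U = 1` (componentwise part).**
(I1′) `Σ_y |(∇CQ*)(z,y)| ≤ α`: the block sums of the free gradient, bounded uniformly in `η` by `blockSum_le_of_cubic`
for the block containing `z` and its neighbours — but in this ABSOLUTE form NOT instantiable for the MASSLESS leg on `ℤ⁴`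
(`Σ_{|y−z|≤N} |z−y|⁻³ ≍ N`; GAPS G-adv2-23 (b), RULING (R3)): the v1 tag «summable over far blocks by the decay of a
μ-regularised kernel» is WITHDRAWN (v1.1; a mass breaks the exactness of §1's Woodbury identity), (I1′) stays as the
algebraic skeleton for absolutely summable legs, and the instantiable replacement is the CANCELLATION FORM
`ParametrixInputsW` of §5 (weighted block sum);
(I2) `Σ_{y′} |K_eff(y,y′)| ≤ κ`: bounded, exponentially decaying unit-lattice kernel of King's effective Laplacian /
(B5)'s `a φ_μ⁻¹`, UNIFORMLY IN `k` — printed: (K) Prop. 3.10 (3.91) «|Δ^{(k)}(p)| ≤ C uniformly in k» (tree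
`King1986.effSymbol_le`) with (B4) Lemma 2.4 (2.35)–(2.37) for the decay (tree
`B4.Lemma24Printed`, `B4Strip`); (I3) `|(QC∇′)(y′,z′)| ≤ β`: as (I1′), pointwise.  All three are asserted of NOTHING
here. [cite: King1986, Prop. 3.10 p.669; Balaban1983RegularityDecay, Lemma 2.4 p.582] -/
structure ParametrixInputs (gradCQ : Y → ℝ) (Keff : Y → Y → ℝ) (QCgrad : Y → ℝ) (α κ β : ℝ) : Prop where
  κ_nonneg : 0 ≤ κ
  β_nonneg : 0 ≤ β
  blockSums : ∑ y, |gradCQ y| ≤ α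
  effKernel : ∀ y, ∑ y', |Keff y y'| ≤ κ
  pointwise : ∀ y', |QCgrad y'| ≤ β

/-- **(H1-par) AT `U = 1`, COMPONENTWISE PART — THE TYPED ESTIMATE.**  Under the three inputs the Woodbury remainder with
one derivative per leg is bounded by `α κ β` — a constant in which NOTHING depends on `k` once (I1′), (I2), (I3) are
k-uniform: the parametrix statement «`G(1) = C_free ⊗ 1 + R`, `∇R∇′` bounded η-uniformly» of BETA-SPEC §8.5 for the
part of the `U = 1` bulk propagator displayed as `⊕_μ O^{(μ)}` in (B5) (1.83). [folklore] -/
theorem parametrixRemainder_le {gradCQ : Y → ℝ} {Keff : Y → Y → ℝ} {QCgrad : Y → ℝ} {α κ β : ℝ}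
    (h : ParametrixInputs gradCQ Keff QCgrad α κ β) : |woodburyRemainder gradCQ Keff QCgrad| ≤ α * κ * β := by
  rw [woodburyRemainder, abs_neg]
  exact abs_sum_sum_mul_mul_le gradCQ Keff QCgrad h.κ_nonneg h.β_nonneg h.blockSums h.effKernel h.pointwise

/-- The same bound for a FAMILY indexed by the scale `k` (fine points and unit sites depending on `k`): if the three
inputs hold with the SAME `α, κ, β` for every `k`, the remainder is bounded by `α κ β` for every `k` — the form in
which (H1-par) feeds `Beta.TransferUV.coeff_of_close` (remainder terms change the accumulated coefficient by `O(1)`).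
[folklore] -/
theorem parametrixRemainder_le_uniform {Yk : ℕ → Type*} [∀ k, Fintype (Yk k)]
    {gradCQ : ∀ k, Yk k → ℝ} {Keff : ∀ k, Yk k → Yk k → ℝ} {QCgrad : ∀ k, Yk k → ℝ} {α κ β : ℝ}
    (h : ∀ k, ParametrixInputs (gradCQ k) (Keff k) (QCgrad k) α κ β) (k : ℕ) :
    |woodburyRemainder (gradCQ k) (Keff k) (QCgrad k)| ≤ α * κ * β :=
  parametrixRemainder_le (h k)

end Composition

/-! ## §4 — Non-vacuity -/

namespace Witness

/-- The Sherman–Morrison hypotheses are satisfiable (one-point fibre, `D = 1`, `w = 1`, `a = 1`: `φ = 2`). [folklore] -/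
theorem shermanMorrison_nonvacuous :
    phi (fun _ : Unit => (1 : ℂ)) 1 (fun _ => 1) ≠ 0 := by
  simp [phi]

/-- The parametrix inputs are satisfiable (one unit site, all kernels `= 1`, `α = κ = β = 1`), and the bound is then
attained: `|−1| ≤ 1`. [folklore] -/
theorem parametrixInputs_nonvacuous :
    ParametrixInputs (fun _ : Unit => (1 : ℝ)) (fun _ _ => 1) (fun _ => 1) 1 1 1 :=
  ⟨zero_le_one, zero_le_one, by simp, fun _ => by simp, fun _ => by simp⟩

example : |woodburyRemainder (fun _ : Unit => (1 : ℝ)) (fun _ _ => 1) (fun _ => 1)| ≤ 1 * 1 * 1 :=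
  parametrixRemainder_le parametrixInputs_nonvacuous

end Witness

/-! ## §5 — THE CANCELLATION FORM (v1.1): `K_eff` annihilates constants, so only DIFFERENCES of the leg enter and the
block sum is WEIGHTED — volume-free constants (answer to GAPS G-adv2-23 / BETA-SPEC §8.6(l) RULING (R3)(ii)) -/

section Cancellation

variable {Y : Type*} [Fintype Y]

/-- **CANCELLATION.**  If a row of the unit-lattice kernel sums to zero, `Σ_{y′} K(y′) = 0`, then against any leg `B`
only differences enter: `Σ_{y′} K(y′) B(y′) = Σ_{y′} K(y′) (B(y′) − b)` for every constant `b` (used with `b = B(y)`).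
In print: (B5) p. 32 (verbatim in the header), the function (1.85) `Δ(p′)φ_μ(p′)` «has a limit as p′ → 0 … bounded from
below and above by positve [sic] constants independent of k» — so the middle factor `a φ_μ(p′)⁻¹ = a Δ(p′)/(Δ(p′)φ_μ(p′))`
of (1.83) VANISHES at `p′ = 0` like `Δ(p′)`: its position-space kernel annihilates constants.  Carried as a hypothesis
(`ParametrixInputsW.cancel`), asserted here of nothing. [cite: Balaban1984PropagatorsI, (1.85) p.32] -/
theorem sum_mul_eq_sum_mul_sub_of_cancel (K B : Y → ℝ) (b : ℝ) (hK : ∑ y', K y' = 0) :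
    ∑ y', K y' * B y' = ∑ y', K y' * (B y' - b) := by
  simp only [mul_sub, Finset.sum_sub_distrib, ← Finset.sum_mul, hK, zero_mul, sub_zero]

/-- The same splitting for an ARBITRARY row (no cancellation assumed): `Σ K B = Σ K (B − b) + (Σ K)·b` — the second
term is the ROW-SUM DEFECT, zero under `cancel`, and exponentially small away from the boundary for the truncation to a
finite volume of a `ℤ⁴` kernel with zero row sums (how the finite-volume theorems below pass to the `T ↗ ℤ⁴` object of
(B12) p. 264 by absolute convergence: `parametrixRemainder_le_defect`). [folklore] -/
theorem sum_mul_eq_sum_mul_sub_add_defect (K B : Y → ℝ) (b : ℝ) :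
    ∑ y', K y' * B y' = ∑ y', K y' * (B y' - b) + (∑ y', K y') * b := by
  rw [Finset.sum_mul, ← Finset.sum_add_distrib]
  refine Finset.sum_congr rfl fun y' _ => ?_
  ring

/-- **WHY THE ROWS CANCEL — AT THE SYMBOL LEVEL (kernel certificate of the mechanism).**  King's effective
Laplacian `Δ^{(k)}(p′) = (a⁻¹ + Σ_l |u(p′+l)|² Δ^η(p′+l)⁻¹)⁻¹` ((K) (4.5); = (B5)'s middle factor `a φ_μ⁻¹` by
`woodbury_effSymbol`) is bounded by the BARE symbol at any one alias: `Δ^{(k)}(p′) ≤ Δ^η(p′+l₀)/|u(p′+l₀)|²`.  At the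
zero alias `l₀ = 0` (`|u(p′)|² → 1`, `Δ^η(p′) ≍ |p′|² → 0`) the effective symbol therefore VANISHES at `p′ = 0` at the
rate of the massless free symbol: the position-space kernel `K_eff` has row sums `Δ^{(k)}(0) = 0` — the field
`ParametrixInputsW.cancel` — and (B5) p. 32's two-sided statement on (1.85) `Δ(p′)φ_μ(p′)` is the matching lower
bound.  Pure algebra of positive reals; asserted of no lattice object. [cite: King1986, (4.5) p.670;
Balaban1984PropagatorsI, (1.85) p.32] -/
theorem effSymbol_le_zeroAlias {ι : Type*} {s : Finset ι} {a : ℝ} (ha : 0 < a) {w A : ι → ℝ}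
    (hw : ∀ i ∈ s, 0 ≤ w i) (hA : ∀ i ∈ s, 0 < A i) {i₀ : ι} (hi₀ : i₀ ∈ s) (hw₀ : 0 < w i₀) :
    King1986.effSymbol s a w A ≤ A i₀ / w i₀ := by
  rw [King1986.effSymbol_eq_inv_effDenom]
  have hpos : 0 < w i₀ * (A i₀)⁻¹ := mul_pos hw₀ (inv_pos.2 (hA i₀ hi₀))
  have hle : w i₀ * (A i₀)⁻¹ ≤ King1986.effDenom s a w A := by
    unfold King1986.effDenom
    have h1 : w i₀ * (A i₀)⁻¹ ≤ ∑ i ∈ s, w i * (A i)⁻¹ :=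
      Finset.single_le_sum (f := fun i => w i * (A i)⁻¹)
        (fun i hi => mul_nonneg (hw i hi) (inv_nonneg.2 (hA i hi).le)) hi₀
    have h2 : 0 < a⁻¹ := inv_pos.2 ha
    linarith
  calc (King1986.effDenom s a w A)⁻¹ ≤ (w i₀ * (A i₀)⁻¹)⁻¹ := inv_anti₀ hpos hle
    _ = A i₀ / w i₀ := by rw [mul_inv, inv_inv, div_eq_inv_mul]

/-- **ONE ROW OF THE KERNEL AGAINST A WEIGHTED-LIPSCHITZ LEG (defect form).**  A leg whose differences obey
`|B(y′) − b| ≤ β₁·ρ(y′)·(W_y + W(y′))` (`b = B(y)`, `ρ` = distance to the row index `y`, `W ≥ 0` a weight: the (L91)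
(1.36) difference SHAPE of the block-averaged gradient of the free propagator with weight `(1 + dist(·, z′))⁻⁴`, see
`ParametrixInputsW`), a weight with the Peetre property `W(y′) ≤ P(y′)·W_y`, and the weighted first moment
`Σ_{y′} |K(y′)|·ρ(y′)·(1 + P(y′)) ≤ κ₁` give `|Σ_{y′} K(y′)B(y′)| ≤ β₁ κ₁ W_y + |Σ_{y′} K(y′)|·|b|`: the row inherits the
DECAY OF THE WEIGHT at `y`, up to the row-sum defect.  No absolute size of `B` (other than at the row index itself, times
the defect) and no absolute row sum of `|K|` is used. [folklore] -/
theorem abs_sum_mul_le_defect (K B : Y → ℝ) (b Wy : ℝ) {W ρ P : Y → ℝ} {β₁ κ₁ : ℝ}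
    (hβ : 0 ≤ β₁) (hWy : 0 ≤ Wy) (hρ : ∀ y', 0 ≤ ρ y')
    (hlip : ∀ y', |B y' - b| ≤ β₁ * ρ y' * (Wy + W y')) (hpeetre : ∀ y', W y' ≤ P y' * Wy)
    (hmom : ∑ y', |K y'| * (ρ y' * (1 + P y')) ≤ κ₁) :
    |∑ y', K y' * B y'| ≤ β₁ * κ₁ * Wy + |∑ y', K y'| * |b| := by
  rw [sum_mul_eq_sum_mul_sub_add_defect K B b]
  refine (abs_add_le _ _).trans (add_le_add ?_ (le_of_eq (abs_mul _ _)))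
  calc |∑ y', K y' * (B y' - b)| ≤ ∑ y', |K y' * (B y' - b)| := Finset.abs_sum_le_sum_abs _ _
    _ = ∑ y', |K y'| * |B y' - b| := by simp_rw [abs_mul]
    _ ≤ ∑ y', |K y'| * (β₁ * ρ y' * (Wy + P y' * Wy)) := by
        refine Finset.sum_le_sum fun y' _ => mul_le_mul_of_nonneg_left ?_ (abs_nonneg _)
        refine (hlip y').trans ?_
        have : Wy + W y' ≤ Wy + P y' * Wy := by linarith [hpeetre y']
        exact mul_le_mul_of_nonneg_left this (mul_nonneg hβ (hρ y'))
    _ = β₁ * Wy * ∑ y', |K y'| * (ρ y' * (1 + P y')) := by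
        rw [Finset.mul_sum]
        refine Finset.sum_congr rfl fun y' _ => ?_
        ring
    _ ≤ β₁ * Wy * κ₁ := mul_le_mul_of_nonneg_left hmom (mul_nonneg hβ hWy)
    _ = β₁ * κ₁ * Wy := by ring

/-- **ONE ROW OF THE CANCELLED KERNEL**: with `Σ_{y′} K(y′) = 0` the defect vanishes and
`|Σ_{y′} K(y′)B(y′)| ≤ β₁ κ₁ W_y`. [folklore] -/
theorem abs_sum_mul_le_of_cancel (K B : Y → ℝ) (b Wy : ℝ) {W ρ P : Y → ℝ} {β₁ κ₁ : ℝ}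
    (hβ : 0 ≤ β₁) (hWy : 0 ≤ Wy) (hρ : ∀ y', 0 ≤ ρ y') (hK : ∑ y', K y' = 0)
    (hlip : ∀ y', |B y' - b| ≤ β₁ * ρ y' * (Wy + W y')) (hpeetre : ∀ y', W y' ≤ P y' * Wy)
    (hmom : ∑ y', |K y'| * (ρ y' * (1 + P y')) ≤ κ₁) :
    |∑ y', K y' * B y'| ≤ β₁ * κ₁ * Wy := by
  have h := abs_sum_mul_le_defect K B b Wy hβ hWy hρ hlip hpeetre hmom
  rwa [hK, abs_zero, zero_mul, add_zero] at h

/-- **HYPOTHESIS SHAPE — THE WEIGHTED INPUTS WITHOUT THE CANCELLATION** (for truncations to a finite volume, where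
the boundary rows of `K_eff` do not sum to zero: `parametrixRemainder_le_defect`).  Fields as in `ParametrixInputsW`
below, minus `cancel`. [folklore] -/
structure WeightedInputs (gradCQ : Y → ℝ) (Keff : Y → Y → ℝ) (QCgrad : Y → ℝ)
    (W : Y → ℝ) (ρ P : Y → Y → ℝ) (αW κ₁ β₁ : ℝ) : Prop where
  κ_nonneg : 0 ≤ κ₁
  β_nonneg : 0 ≤ β₁
  W_nonneg : ∀ y, 0 ≤ W y
  ρ_nonneg : ∀ y y', 0 ≤ ρ y y'
  moment : ∀ y, ∑ y', |Keff y y'| * (ρ y y' * (1 + P y y')) ≤ κ₁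
  lipschitzW : ∀ y y', |QCgrad y' - QCgrad y| ≤ β₁ * ρ y y' * (W y + W y')
  peetre : ∀ y y', W y' ≤ P y y' * W y
  blockSumsW : ∑ y, |gradCQ y| * W y ≤ αW

/-- **THE DEFECT FORM OF THE ESTIMATE.**  Without assuming the cancellation, the Woodbury remainder obeys
`|(∇R∇′)(z,z′)| ≤ α_W κ₁ β₁ + Σ_y |(∇CQ*)(z,y)|·|Σ_{y′} K_eff(y,y′)|·|(QC∇′)(y,z′)|`; the defect term vanishes under
`cancel`, and for the truncation `Y_N ↗ ℤ⁴` of kernels with zero row sums on `ℤ⁴` it tends to `0` (both legs decay like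
`dist⁻³`, the defect is supported near the truncation boundary) — so the volume-free bound passes to the `ℤ⁴` object by
absolute convergence of the defining double sum (`Σ_y dist(z,y)⁻³ dist(y,z′)⁻³ < ∞` in `d = 4`). [folklore] -/
theorem parametrixRemainder_le_defect {gradCQ : Y → ℝ} {Keff : Y → Y → ℝ} {QCgrad : Y → ℝ}
    {W : Y → ℝ} {ρ P : Y → Y → ℝ} {αW κ₁ β₁ : ℝ}
    (h : WeightedInputs gradCQ Keff QCgrad W ρ P αW κ₁ β₁) :
    |woodburyRemainder gradCQ Keff QCgrad|
      ≤ αW * κ₁ * β₁ + ∑ y, |gradCQ y| * |∑ y', Keff y y'| * |QCgrad y| := by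
  rw [woodburyRemainder, abs_neg]
  have hrow : ∀ y, |∑ y', Keff y y' * QCgrad y'| ≤ β₁ * κ₁ * W y + |∑ y', Keff y y'| * |QCgrad y| := fun y =>
    abs_sum_mul_le_defect (Keff y) QCgrad (QCgrad y) (W y) h.β_nonneg (h.W_nonneg y) (h.ρ_nonneg y)
      (h.lipschitzW y) (h.peetre y) (h.moment y)
  calc |∑ y, ∑ y', gradCQ y * Keff y y' * QCgrad y'|
      ≤ ∑ y, |∑ y', gradCQ y * Keff y y' * QCgrad y'| := Finset.abs_sum_le_sum_abs _ _
    _ = ∑ y, |gradCQ y| * |∑ y', Keff y y' * QCgrad y'| := by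
        refine Finset.sum_congr rfl fun y _ => ?_
        rw [← abs_mul, Finset.mul_sum]
        refine congrArg _ (Finset.sum_congr rfl fun y' _ => ?_)
        ring
    _ ≤ ∑ y, |gradCQ y| * (β₁ * κ₁ * W y + |∑ y', Keff y y'| * |QCgrad y|) :=
        Finset.sum_le_sum fun y _ => mul_le_mul_of_nonneg_left (hrow y) (abs_nonneg _)
    _ = β₁ * κ₁ * ∑ y, |gradCQ y| * W y + ∑ y, |gradCQ y| * |∑ y', Keff y y'| * |QCgrad y| := by
        rw [Finset.mul_sum, ← Finset.sum_add_distrib]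
        refine Finset.sum_congr rfl fun y _ => ?_
        ring
    _ ≤ β₁ * κ₁ * αW + ∑ y, |gradCQ y| * |∑ y', Keff y y'| * |QCgrad y| :=
        add_le_add (mul_le_mul_of_nonneg_left h.blockSumsW (mul_nonneg h.β_nonneg h.κ_nonneg)) le_rfl
    _ = αW * κ₁ * β₁ + ∑ y, |gradCQ y| * |∑ y', Keff y y'| * |QCgrad y| := by ring

/-- **HYPOTHESIS SHAPE — THE CANCELLATION FORM OF THE (H1-par) INPUTS AT `U = 1` (componentwise part; v1.1).**
WHY (GAPS G-adv2-23 (b), RULING (R3)): the ABSOLUTE input (I1′) `Σ_y |(∇CQ*)(z,y)| ≤ α` of `ParametrixInputs` is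
correct algebra but NOT instantiable for the MASSLESS leg on `ℤ⁴`: `|(∇CQ*)(z,y)| ≍ |z−y|⁻³` gives
`Σ_{|y|≤N} ≍ N`, and the β-function object is the `T ↗ ℤ^d` limit ((B12) p. 264), so only VOLUME-FREE constants count.
The finiteness mechanism is the cancellation: `K_eff` annihilates constants (`cancel`, (B5) (1.85) p. 32), so the leg
`(QC∇′)(·, z′)` enters only through DIFFERENCES, which decay one power faster.  The inputs, at fixed fine points `z, z′`,
over the unit sites `Y` of the volume, with a distance-like `ρ(y,y′) ≥ 0`, a weight `W ≥ 0` and a Peetre factor `P`: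
* `cancel`     `Σ_{y′} K_eff(y,y′) = 0` for every `y`;
* `moment`     `Σ_{y′} |K_eff(y,y′)|·ρ(y,y′)·(1 + P(y,y′)) ≤ κ₁` — a WEIGHTED FIRST MOMENT of the unit-lattice kernel,
  finite uniformly in `k` for an exponentially decaying kernel (printed TYPE: (K) Prop. 3.10 p. 669 with (B4) Lemma 2.4
  (2.35)–(2.37) p. 582; dictionary `ρ = dist`, `P = (1 + dist)⁴`);
* `lipschitzW` `|(QC∇′)(y′,z′) − (QC∇′)(y,z′)| ≤ β₁·ρ(y,y′)·(W(y) + W(y′))` with `W = w₀·(1 + dist(·,z′))⁻⁴` — the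
  difference of the block-averaged free gradient along a path of `ρ(y,y′)` unit steps, each step a block-averaged SECOND
  difference `≲ dist⁻⁴` ((L91) Thm. 1.5.5 (1.36): `∇_yG(x) = a_d|y|D_u(|x|^{2−d}) + O(|x|^{−d})`, so unit differences
  of `∇G` are `O(|x|^{−d})`), the larger of the two endpoint weights covering both orders of the path; for the blocks
  adjacent to `z′` the trivial bound `|B(y′)| + |B(y)| ≤ 2β` (v1 `blockSum_le_of_cubic`) is of the same form;
* `peetre`     `W(y′) ≤ P(y,y′)·W(y)` — for the dictionary weights this IS the triangle inequality (`peetre_of_triangle`);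
* `blockSumsW` `Σ_y |(∇CQ*)(z,y)|·W(y) ≤ α_W` — the WEIGHTED block sum, `≲ Σ_y (1+dist(z,y))⁻³(1+dist(y,z′))⁻⁴`,
  finite on `ℤ⁴` with a volume-free constant (`weightedPair_sum_le`: `≤ 322` per unit of the two decay constants).
All five are asserted here of NOTHING; the dictionary instances are the elementary lemmas of §6.
[cite: Balaban1984PropagatorsI, (1.85) p.32; King1986, Prop. 3.10 p.669; Lawler1991, Thm. 1.5.5 (1.36)] -/
structure ParametrixInputsW (gradCQ : Y → ℝ) (Keff : Y → Y → ℝ) (QCgrad : Y → ℝ)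
    (W : Y → ℝ) (ρ P : Y → Y → ℝ) (αW κ₁ β₁ : ℝ) : Prop where
  κ_nonneg : 0 ≤ κ₁
  β_nonneg : 0 ≤ β₁
  W_nonneg : ∀ y, 0 ≤ W y
  ρ_nonneg : ∀ y y', 0 ≤ ρ y y'
  cancel : ∀ y, ∑ y', Keff y y' = 0
  moment : ∀ y, ∑ y', |Keff y y'| * (ρ y y' * (1 + P y y')) ≤ κ₁
  lipschitzW : ∀ y y', |QCgrad y' - QCgrad y| ≤ β₁ * ρ y y' * (W y + W y')
  peetre : ∀ y y', W y' ≤ P y y' * W y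
  blockSumsW : ∑ y, |gradCQ y| * W y ≤ αW

/-- **(H1-par) AT `U = 1`, COMPONENTWISE PART — THE CANCELLATION-FORM ESTIMATE (v1.1).**  Under `ParametrixInputsW`
the Woodbury remainder with one derivative per leg obeys `|(∇R∇′)(z,z′)| ≤ α_W κ₁ β₁`; nothing in the constant refers
to the volume or to `k` once the five inputs are volume-free and k-uniform, and NO absolute block sum of the massless
leg is ever formed (the objection G-adv2-23 (b) to the absolute form).  The v1 theorem `parametrixRemainder_le`
remains the correct algebraic skeleton for any leg with an absolutely summable block sum (e.g. a massive one).
[folklore] -/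
theorem parametrixRemainder_le_cancel {gradCQ : Y → ℝ} {Keff : Y → Y → ℝ} {QCgrad : Y → ℝ}
    {W : Y → ℝ} {ρ P : Y → Y → ℝ} {αW κ₁ β₁ : ℝ}
    (h : ParametrixInputsW gradCQ Keff QCgrad W ρ P αW κ₁ β₁) :
    |woodburyRemainder gradCQ Keff QCgrad| ≤ αW * κ₁ * β₁ := by
  have h' : WeightedInputs gradCQ Keff QCgrad W ρ P αW κ₁ β₁ :=
    ⟨h.κ_nonneg, h.β_nonneg, h.W_nonneg, h.ρ_nonneg, h.moment, h.lipschitzW, h.peetre, h.blockSumsW⟩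
  have hd := parametrixRemainder_le_defect h'
  simp only [h.cancel, abs_zero, mul_zero, zero_mul, Finset.sum_const_zero, add_zero] at hd
  exact hd

/-- The cancellation-form bound for a FAMILY indexed by the scale `k` (unit sites, kernels, weights depending on `k`,
the three constants NOT): `|(∇R∇′)| ≤ α_W κ₁ β₁` for every `k` — the form in which it feeds
`Beta.TransferUV.coeff_of_close`. [folklore] -/
theorem parametrixRemainder_le_cancel_uniform {Yk : ℕ → Type*} [∀ k, Fintype (Yk k)]
    {gradCQ : ∀ k, Yk k → ℝ} {Keff : ∀ k, Yk k → Yk k → ℝ} {QCgrad : ∀ k, Yk k → ℝ}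
    {W : ∀ k, Yk k → ℝ} {ρ P : ∀ k, Yk k → Yk k → ℝ} {αW κ₁ β₁ : ℝ}
    (h : ∀ k, ParametrixInputsW (gradCQ k) (Keff k) (QCgrad k) (W k) (ρ k) (P k) αW κ₁ β₁) (k : ℕ) :
    |woodburyRemainder (gradCQ k) (Keff k) (QCgrad k)| ≤ αW * κ₁ * β₁ :=
  parametrixRemainder_le_cancel (h k)

end Cancellation

/-! ## §6 — The dictionary instances are VOLUME-FREE: Peetre from the triangle inequality, and the weighted pair sums
`Σ_y (1+dist(z,y))^{−p}(1+dist(y,z′))^{−q} ≤ 2(S₀+2S)` (`= 322` on `ℤ⁴`) for `p + q ≥ 5`, from shell counting in `d = 4` -/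

/-- **PEETRE FROM THE TRIANGLE INEQUALITY.**  For `a, b, c ≥ 0` with `c ≤ a + b` and any power `p`:
`(1+b)^{−p} ≤ (1+a)^p · (1+c)^{−p}` (since `1 + c ≤ (1+a)(1+b)`).  Dictionary: `a = dist(y,y′)`, `b = dist(y′,z′)`,
`c = dist(y,z′)`, `p = 4`: the weight `W = w₀(1+dist(·,z′))⁻⁴` has `W(y′) ≤ (1+dist(y,y′))⁴·W(y)` — the field
`ParametrixInputsW.peetre` with `P(y,y′) = (1+dist(y,y′))⁴`. [folklore] -/
theorem peetre_of_triangle {a b c : ℝ} (ha : 0 ≤ a) (hb : 0 ≤ b) (hc : 0 ≤ c) (h : c ≤ a + b) (p : ℕ) :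
    1 / (1 + b) ^ p ≤ (1 + a) ^ p * (1 / (1 + c) ^ p) := by
  have key : (1 + c) ^ p ≤ ((1 + b) * (1 + a)) ^ p :=
    pow_le_pow_left₀ (by linarith) (by nlinarith) p
  rw [mul_one_div, le_div_iff₀ (by positivity), one_div, inv_mul_le_iff₀ (by positivity), ← mul_pow]
  exact key

/-- `a^p b^q ≤ a^{p+q} + b^{p+q}` for `a, b ≥ 0` (compare with the larger of the two). [folklore] -/
theorem pow_mul_pow_le_add {a b : ℝ} (ha : 0 ≤ a) (hb : 0 ≤ b) (p q : ℕ) :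
    a ^ p * b ^ q ≤ a ^ (p + q) + b ^ (p + q) := by
  rcases le_total a b with h | h
  · have hp : a ^ p ≤ b ^ p := pow_le_pow_left₀ ha h p
    calc a ^ p * b ^ q ≤ b ^ p * b ^ q := mul_le_mul_of_nonneg_right hp (by positivity)
      _ = b ^ (p + q) := by rw [pow_add]
      _ ≤ a ^ (p + q) + b ^ (p + q) := le_add_of_nonneg_left (by positivity)
  · have hq : b ^ q ≤ a ^ q := pow_le_pow_left₀ hb h q
    calc a ^ p * b ^ q ≤ a ^ p * a ^ q := mul_le_mul_of_nonneg_left hq (by positivity)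
      _ = a ^ (p + q) := by rw [pow_add]
      _ ≤ a ^ (p + q) + b ^ (p + q) := le_add_of_nonneg_right (by positivity)

section ShellCount

variable {Y : Type*} [Fintype Y]

/-- **SHELL COUNTING ⇒ A VOLUME-FREE `(1+ℓ)⁻ⁿ` SUM, `n ≥ 5`.**  If a level function `ℓ : Y → ℕ` (distance of the unit
site to a fixed point) has at most `S₀` sites at level `0` and at most `S·(r+1)³` sites at level `r+1` (the sup-norm
shell count of `ℤ⁴` has `S₀ = 1`, `S = 80`, `Beta.TransferUV.card_annulus_succ_four_le`; the periodic sup-distance on a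
torus has the same counts, its shells being images of sub-shells of `ℤ⁴`; unit BONDS have `S₀ = 4`, `S = 320`), then for
every `n ≥ 5` (one power better than the dimension): `Σ_y (1+ℓ(y))⁻ⁿ ≤ S₀ + S·Σ_r (r+1)^{3−n} ≤ S₀ + 2S`, WHATEVER the
(finite) volume `Y`. [folklore] -/
theorem sum_inv_pow_le_of_shellCount (ℓ : Y → ℕ) {n : ℕ} (hn : 5 ≤ n) {S₀ S : ℝ} (hS : 0 ≤ S)
    (h0 : ((Finset.univ.filter fun y => ℓ y = 0).card : ℝ) ≤ S₀)
    (hshell : ∀ r : ℕ, ((Finset.univ.filter fun y => ℓ y = r + 1).card : ℝ) ≤ S * ((r : ℝ) + 1) ^ 3) :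
    ∑ y, (1 / (1 + (ℓ y : ℝ))) ^ n ≤ S₀ + 2 * S := by
  classical
  set R : ℕ := Finset.univ.sup ℓ with hR
  have hmaps : ∀ y ∈ (Finset.univ : Finset Y), ℓ y ∈ Finset.range (R + 1) := fun y _ =>
    Finset.mem_range.2 (Nat.lt_succ_of_le (Finset.le_sup (f := ℓ) (Finset.mem_univ y)))
  rw [← Finset.sum_fiberwise_of_maps_to hmaps]
  have hfib : ∀ r : ℕ, ∑ y ∈ Finset.univ.filter (fun y => ℓ y = r), (1 / (1 + (ℓ y : ℝ))) ^ n
      = ((Finset.univ.filter fun y => ℓ y = r).card : ℝ) * (1 / (1 + (r : ℝ))) ^ n := by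
    intro r
    rw [Finset.sum_congr rfl fun y hy => by rw [(Finset.mem_filter.1 hy).2], Finset.sum_const, nsmul_eq_mul]
  simp_rw [hfib]
  rw [Finset.sum_range_succ']
  have hzero : ((Finset.univ.filter fun y => ℓ y = 0).card : ℝ) * (1 / (1 + ((0 : ℕ) : ℝ))) ^ n ≤ S₀ := by
    simpa using h0
  have hterm : ∀ r ∈ Finset.range R,
      ((Finset.univ.filter fun y => ℓ y = r + 1).card : ℝ) * (1 / (1 + ((r + 1 : ℕ) : ℝ))) ^ n
        ≤ S * (1 / ((r : ℝ) + 1) ^ 2) := by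
    intro r _
    have hr : (0 : ℝ) < (r : ℝ) + 1 := by positivity
    have hu1 : 1 / ((r : ℝ) + 1) ≤ 1 := by
      rw [div_le_one hr]
      linarith
    have hle : (1 / (1 + ((r + 1 : ℕ) : ℝ))) ^ n ≤ (1 / ((r : ℝ) + 1)) ^ n := by
      apply pow_le_pow_left₀ (by positivity)
      push_cast
      exact one_div_le_one_div_of_le hr (by linarith)
    have hsplit : ((r : ℝ) + 1) ^ 3 * (1 / ((r : ℝ) + 1)) ^ n = (1 / ((r : ℝ) + 1)) ^ (n - 3) := by
      obtain ⟨m, rfl⟩ : ∃ m, n = m + 3 := ⟨n - 3, by omega⟩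
      rw [Nat.add_sub_cancel, pow_add]
      field_simp
    have hpow : (1 / ((r : ℝ) + 1)) ^ (n - 3) ≤ (1 / ((r : ℝ) + 1)) ^ 2 :=
      pow_le_pow_of_le_one (by positivity) hu1 (by omega)
    calc ((Finset.univ.filter fun y => ℓ y = r + 1).card : ℝ) * (1 / (1 + ((r + 1 : ℕ) : ℝ))) ^ n
        ≤ S * ((r : ℝ) + 1) ^ 3 * (1 / ((r : ℝ) + 1)) ^ n :=
          mul_le_mul (hshell r) hle (by positivity) (by positivity)
      _ = S * ((1 / ((r : ℝ) + 1)) ^ (n - 3)) := by rw [mul_assoc, hsplit]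
      _ ≤ S * (1 / ((r : ℝ) + 1)) ^ 2 := mul_le_mul_of_nonneg_left hpow hS
      _ = S * (1 / ((r : ℝ) + 1) ^ 2) := by rw [div_pow, one_pow]
  calc ∑ r ∈ Finset.range R, ((Finset.univ.filter fun y => ℓ y = r + 1).card : ℝ) * (1 / (1 + ((r + 1 : ℕ) : ℝ))) ^ n
        + ((Finset.univ.filter fun y => ℓ y = 0).card : ℝ) * (1 / (1 + ((0 : ℕ) : ℝ))) ^ n
      ≤ ∑ r ∈ Finset.range R, S * (1 / ((r : ℝ) + 1) ^ 2) + S₀ := add_le_add (Finset.sum_le_sum hterm) hzero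
    _ = S * ∑ r ∈ Finset.range R, 1 / ((r : ℝ) + 1) ^ 2 + S₀ := by rw [Finset.mul_sum]
    _ ≤ S * 2 + S₀ := by
        have := sum_inv_pow_le_two (p := 2) le_rfl R
        nlinarith
    _ = S₀ + 2 * S := by ring

/-- **THE WEIGHTED PAIR SUM IS VOLUME-FREE.**  For two level functions `ℓ` (distance to `z`) and `ℓ′` (distance to `z′`)
with shell counts `(S₀, S)` and exponents `p + q ≥ 5` (total decay one power better than the dimension):
`Σ_y (1+ℓ(y))^{−p}·(1+ℓ′(y))^{−q} ≤ 2(S₀ + 2S)` (termwise `a^p b^q ≤ a^{p+q} + b^{p+q}`, then twice the one-centre sum;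
`= 322` for sites of `ℤ⁴`) — independently of the volume and of `z, z′`.  Instances: `(p,q) = (3,4)` is the lattice sum
behind `ParametrixInputsW.blockSumsW` for `∇R∇′` (gradient-decay of `(∇CQ*)(z,·)` times the weight
`(1+dist(·,z′))⁻⁴`); `(2,3)`, `(3,3)`, `(2,4)` serve the remainders `R`, `∇R`, `R∇′` with fewer derivatives. [folklore] -/
theorem weightedPair_sum_le (ℓ ℓ' : Y → ℕ) {p q : ℕ} (hpq : 5 ≤ p + q) {S₀ S : ℝ} (hS : 0 ≤ S)
    (h0 : ((Finset.univ.filter fun y => ℓ y = 0).card : ℝ) ≤ S₀)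
    (hshell : ∀ r : ℕ, ((Finset.univ.filter fun y => ℓ y = r + 1).card : ℝ) ≤ S * ((r : ℝ) + 1) ^ 3)
    (h0' : ((Finset.univ.filter fun y => ℓ' y = 0).card : ℝ) ≤ S₀)
    (hshell' : ∀ r : ℕ, ((Finset.univ.filter fun y => ℓ' y = r + 1).card : ℝ) ≤ S * ((r : ℝ) + 1) ^ 3) :
    ∑ y, (1 / (1 + (ℓ y : ℝ))) ^ p * (1 / (1 + (ℓ' y : ℝ))) ^ q ≤ 2 * (S₀ + 2 * S) := by
  calc ∑ y, (1 / (1 + (ℓ y : ℝ))) ^ p * (1 / (1 + (ℓ' y : ℝ))) ^ q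
      ≤ ∑ y, ((1 / (1 + (ℓ y : ℝ))) ^ (p + q) + (1 / (1 + (ℓ' y : ℝ))) ^ (p + q)) :=
        Finset.sum_le_sum fun y _ => pow_mul_pow_le_add (by positivity) (by positivity) p q
    _ = ∑ y, (1 / (1 + (ℓ y : ℝ))) ^ (p + q) + ∑ y, (1 / (1 + (ℓ' y : ℝ))) ^ (p + q) := Finset.sum_add_distrib
    _ ≤ (S₀ + 2 * S) + (S₀ + 2 * S) := add_le_add (sum_inv_pow_le_of_shellCount ℓ hpq hS h0 hshell)
        (sum_inv_pow_le_of_shellCount ℓ' hpq hS h0' hshell')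
    _ = 2 * (S₀ + 2 * S) := by ring

/-- **`blockSumsW` FROM DECAY, VOLUME-FREE.**  If `|(∇CQ*)(z,y)| ≤ α₀(1+ℓ(y))⁻³` (gradient decay of the free
propagator, block-averaged: (L91) (1.36) with v1 `blockSum_le_of_cubic` for the near blocks) and
`0 ≤ W(y) ≤ w₀(1+ℓ′(y))⁻⁴`, then `Σ_y |(∇CQ*)(z,y)|·W(y) ≤ 2(S₀+2S)·α₀·w₀` in EVERY volume with shell counts `(S₀, S)`
— the field `ParametrixInputsW.blockSumsW` with a volume-free `α_W` (`= 322·α₀w₀` on `ℤ⁴`). [folklore] -/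
theorem blockSumsW_of_decay {gradCQ W : Y → ℝ} (ℓ ℓ' : Y → ℕ) {S₀ S α₀ w₀ : ℝ} (hS : 0 ≤ S) (hα : 0 ≤ α₀)
    (hw : 0 ≤ w₀)
    (h0 : ((Finset.univ.filter fun y => ℓ y = 0).card : ℝ) ≤ S₀)
    (hshell : ∀ r : ℕ, ((Finset.univ.filter fun y => ℓ y = r + 1).card : ℝ) ≤ S * ((r : ℝ) + 1) ^ 3)
    (h0' : ((Finset.univ.filter fun y => ℓ' y = 0).card : ℝ) ≤ S₀)
    (hshell' : ∀ r : ℕ, ((Finset.univ.filter fun y => ℓ' y = r + 1).card : ℝ) ≤ S * ((r : ℝ) + 1) ^ 3)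
    (hA : ∀ y, |gradCQ y| ≤ α₀ * (1 / (1 + (ℓ y : ℝ))) ^ 3)
    (hWnn : ∀ y, 0 ≤ W y) (hW : ∀ y, W y ≤ w₀ * (1 / (1 + (ℓ' y : ℝ))) ^ 4) :
    ∑ y, |gradCQ y| * W y ≤ 2 * (S₀ + 2 * S) * α₀ * w₀ := by
  calc ∑ y, |gradCQ y| * W y
      ≤ ∑ y, α₀ * (1 / (1 + (ℓ y : ℝ))) ^ 3 * (w₀ * (1 / (1 + (ℓ' y : ℝ))) ^ 4) :=
        Finset.sum_le_sum fun y _ => mul_le_mul (hA y) (hW y) (hWnn y) (by positivity)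
    _ = α₀ * w₀ * ∑ y, (1 / (1 + (ℓ y : ℝ))) ^ 3 * (1 / (1 + (ℓ' y : ℝ))) ^ 4 := by
        rw [Finset.mul_sum]
        refine Finset.sum_congr rfl fun y _ => ?_
        ring
    _ ≤ α₀ * w₀ * (2 * (S₀ + 2 * S)) :=
        mul_le_mul_of_nonneg_left (weightedPair_sum_le ℓ ℓ' (by norm_num) hS h0 hshell h0' hshell')
          (by positivity)
    _ = 2 * (S₀ + 2 * S) * α₀ * w₀ := by ring

end ShellCount

/-! ### The `ℤ⁴` shell counts for unit sites embedded in `ℤ⁴` (the `T ↗ ℤ⁴` object of (B12) p. 264) -/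

section SupNorm

/-- The sup norm `‖x‖_∞ = max_i |x_i|` of a lattice point, as a natural number. [folklore] -/
def supNorm {d : ℕ} (x : Fin d → ℤ) : ℕ := Finset.univ.sup fun i => (x i).natAbs

/-- `‖x‖_∞ ≤ r` iff `x ∈ box d r` (the tree's `LatticeModels.box`). [folklore] -/
theorem mem_box_iff_supNorm_le {d r : ℕ} {x : Fin d → ℤ} : x ∈ box d r ↔ supNorm x ≤ r := by
  rw [mem_box, supNorm, Finset.sup_le_iff]
  constructor
  · intro h i _
    have := h i
    omega
  · intro h i
    have := h i (Finset.mem_univ i)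
    omega

/-- Level `r+1` of the sup norm is the shell `annulus d r (r+1)`. [folklore] -/
theorem mem_annulus_of_supNorm_eq {d r : ℕ} {x : Fin d → ℤ} (h : supNorm x = r + 1) : x ∈ annulus d r (r + 1) := by
  rw [mem_annulus, mem_box_iff_supNorm_le, mem_box_iff_supNorm_le]
  omega

/-- Level `0` of the sup norm is the origin. [folklore] -/
theorem eq_zero_of_supNorm_eq_zero {d : ℕ} {x : Fin d → ℤ} (h : supNorm x = 0) : x = 0 := by
  funext i
  have hi : (x i).natAbs ≤ 0 := by
    rw [← h, supNorm]
    exact Finset.le_sup (f := fun i => (x i).natAbs) (Finset.mem_univ i)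
  simpa using hi

variable {Y : Type*} [Fintype Y]

/-- **SHELL COUNT ON `ℤ⁴`.**  For unit sites embedded injectively in `ℤ⁴` (`e : Y ↪ ℤ⁴`, any finite volume) and any
centre `z`, at most `#annulus 4 r (r+1) ≤ 80(r+1)³` sites lie at sup-distance `r+1` from `z`. [folklore] -/
theorem shellCount_of_embedding (e : Y ↪ (Fin 4 → ℤ)) (z : Fin 4 → ℤ) (r : ℕ) :
    ((Finset.univ.filter fun y => supNorm (e y - z) = r + 1).card : ℝ) ≤ 80 * ((r : ℝ) + 1) ^ 3 := by
  classical
  refine le_trans ?_ (card_annulus_succ_four_le r)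
  exact_mod_cast Finset.card_le_card_of_injOn (fun y => e y - z)
    (fun y hy => by
      simp only [Finset.coe_filter, Set.mem_setOf_eq, Finset.mem_univ, true_and] at hy
      exact mem_annulus_of_supNorm_eq hy)
    (fun y₁ _ y₂ _ h => e.injective (sub_left_injective h))

/-- At most one embedded site sits AT the centre. [folklore] -/
theorem zeroCount_of_embedding (e : Y ↪ (Fin 4 → ℤ)) (z : Fin 4 → ℤ) :
    ((Finset.univ.filter fun y => supNorm (e y - z) = 0).card : ℝ) ≤ 1 := by
  classical
  have h : (Finset.univ.filter fun y => supNorm (e y - z) = 0).card ≤ 1 := by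
    refine Finset.card_le_one.2 fun y₁ h₁ y₂ h₂ => ?_
    simp only [Finset.mem_filter, Finset.mem_univ, true_and] at h₁ h₂
    have e₁ := eq_zero_of_supNorm_eq_zero h₁
    have e₂ := eq_zero_of_supNorm_eq_zero h₂
    exact e.injective (by rw [sub_eq_zero] at e₁ e₂; rw [e₁, e₂])
  exact_mod_cast h

/-- **THE WEIGHTED PAIR SUM ON `ℤ⁴`, ANY FINITE VOLUME, ANY TWO CENTRES, TOTAL DECAY `p + q ≥ 5`: `≤ 322`.**
[folklore] -/
theorem weightedPair_sum_le_of_embedding (e : Y ↪ (Fin 4 → ℤ)) (z z' : Fin 4 → ℤ) {p q : ℕ} (hpq : 5 ≤ p + q) :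
    ∑ y, (1 / (1 + (supNorm (e y - z) : ℝ))) ^ p * (1 / (1 + (supNorm (e y - z') : ℝ))) ^ q ≤ 322 := by
  have h := weightedPair_sum_le _ _ hpq (by norm_num : (0 : ℝ) ≤ 80) (zeroCount_of_embedding e z)
    (shellCount_of_embedding e z) (zeroCount_of_embedding e z') (shellCount_of_embedding e z')
  exact h.trans (by norm_num)

end SupNorm

/-! ## §7 — Non-vacuity of the cancellation form -/

namespace Witness

/-- Two unit sites; `K_eff = [[1,−1],[−1,1]]` (rows sum to zero), leg `B = (0,1)`, `ρ` = discrete distance, `W = P = 1`,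
`gradCQ = 1`: `ParametrixInputsW` holds with `α_W = 2, κ₁ = 2, β₁ = 1`, and the remainder is `0 ≤ 4`. [folklore] -/
theorem parametrixInputsW_nonvacuous :
    ParametrixInputsW (fun _ : Fin 2 => (1 : ℝ)) (fun y y' => if y = y' then 1 else -1)
      (fun y => ((y : ℕ) : ℝ)) (fun _ => 1) (fun y y' => if y = y' then 0 else 1) (fun _ _ => 1) 2 2 1 := by
  refine ⟨by norm_num, by norm_num, fun _ => by norm_num, fun y y' => by split_ifs <;> norm_num, ?_, ?_, ?_, ?_, ?_⟩
  · intro y; fin_cases y <;> simp [Fin.sum_univ_two]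
  · intro y; fin_cases y <;> simp [Fin.sum_univ_two] <;> norm_num
  · intro y y'; fin_cases y <;> fin_cases y' <;> simp
  · intro y y'; simp
  · simp

example : |woodburyRemainder (fun _ : Fin 2 => (1 : ℝ)) (fun y y' => if y = y' then 1 else -1)
    (fun y => ((y : ℕ) : ℝ))| ≤ 2 * 2 * 1 :=
  parametrixRemainder_le_cancel parametrixInputsW_nonvacuous

/-- The shell-count hypotheses are satisfiable and the pair-sum bound is then effective: one site at the origin of
`ℤ⁴` gives `1 ≤ 322`. [folklore] -/
example : ∑ y : Unit, (1 / (1 + (supNorm ((Function.Embedding.mk (fun _ : Unit => (0 : Fin 4 → ℤ))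
    (fun _ _ _ => rfl)) y - 0) : ℝ))) ^ 3 *
    (1 / (1 + (supNorm ((Function.Embedding.mk (fun _ : Unit => (0 : Fin 4 → ℤ)) (fun _ _ _ => rfl)) y - 0) : ℝ))) ^ 4
    ≤ 322 :=
  weightedPair_sum_le_of_embedding _ 0 0 (by norm_num)

end Witness

/-! ## §8 — The TWO-LEG absolute bound: boundedness of `∇R∇′` on `ℤ⁴` needs NO cancellation (v1.2)

What G-adv2-23 (b) kills is v1's FACTORISATION `(Σ_y |∇CQ*(z,y)|)·(sup_y Σ_{y′}|K_eff|)·(sup |QC∇′|)`, which discards the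
decay of the second leg.  Keeping BOTH legs' decay — `|(∇CQ*)(z,y)| ≲ (1+dist(z,y))⁻³` and `|(QC∇′)(y′,z′)| ≲ (1+dist(y′,z′))⁻³`
— and moving the second leg's weight across the exponentially localised `K_eff` by Peetre (`(1+dist(y′,z′))⁻³ ≤
(1+dist(y,y′))³(1+dist(y,z′))⁻³`, paid by a THIRD ROW-MOMENT of `K_eff`) leaves the doubly-weighted block sum
`Σ_y (1+dist(z,y))⁻³(1+dist(y,z′))⁻³`, which CONVERGES on `ℤ⁴` (total decay `3 + 3 = 6 > d = 4`; `≤ 322`, §6 with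
`(p,q) = (3,3)`), uniformly in the volume and in `z, z′`.  So `sup_{z,z′} |(∇R∇′)(z,z′)| ≤ 322·α₀β₀κ₃` from three decay
constants alone; the cancellation form of §5 is TRUE AS WELL and gives one power more (total `7`), which matters for
moments / long-range SIZE of `R` (`R ≈ C` at long range since `K̂_eff(0) = 0`), not for local boundedness.
-/

section TwoLeg

variable {Y : Type*} [Fintype Y]

/-- **THE TWO-LEG COMPOSITION BOUND.**  For a three-factor kernel `Σ_{y,y′} A(y)K(y,y′)B(y′)` with `|A| ≤ α₀·a`,
`|B| ≤ β₀·b`, a Peetre-type weight transport `b(y′) ≤ P(y,y′)·b(y)`, row moments `Σ_{y′}|K(y,y′)|P(y,y′) ≤ κ` and the pair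
sum `Σ_y a(y)b(y) ≤ Λ`: `|Σ_{y,y′} A K B| ≤ α₀β₀κΛ`.  No row sum of `K` alone, no sum of one leg alone. [folklore] -/
theorem abs_sum_sum_mul_mul_le_twoLeg (A : Y → ℝ) (K : Y → Y → ℝ) (B : Y → ℝ) (a b : Y → ℝ) (P : Y → Y → ℝ)
    {α₀ β₀ κ Λ : ℝ} (hα : 0 ≤ α₀) (hβ : 0 ≤ β₀) (hκ : 0 ≤ κ) (hb : ∀ y, 0 ≤ b y)
    (hA : ∀ y, |A y| ≤ α₀ * a y) (hB : ∀ y', |B y'| ≤ β₀ * b y') (hpeetre : ∀ y y', b y' ≤ P y y' * b y)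
    (hmoment : ∀ y, ∑ y', |K y y'| * P y y' ≤ κ) (hpair : ∑ y, a y * b y ≤ Λ) :
    |∑ y, ∑ y', A y * K y y' * B y'| ≤ α₀ * β₀ * κ * Λ := by
  have hrow : ∀ y, ∑ y', |A y * K y y' * B y'| ≤ |A y| * (β₀ * b y) * κ := by
    intro y
    calc ∑ y', |A y * K y y' * B y'|
        = ∑ y', |A y| * |K y y'| * |B y'| := by simp_rw [abs_mul]
      _ ≤ ∑ y', |A y| * |K y y'| * (β₀ * (P y y' * b y)) :=
          Finset.sum_le_sum fun y' _ => mul_le_mul_of_nonneg_left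
            ((hB y').trans (mul_le_mul_of_nonneg_left (hpeetre y y') hβ)) (by positivity)
      _ = |A y| * (β₀ * b y) * ∑ y', |K y y'| * P y y' := by
          rw [Finset.mul_sum]
          exact Finset.sum_congr rfl fun y' _ => by ring
      _ ≤ |A y| * (β₀ * b y) * κ :=
          mul_le_mul_of_nonneg_left (hmoment y) (mul_nonneg (abs_nonneg _) (mul_nonneg hβ (hb y)))
  calc |∑ y, ∑ y', A y * K y y' * B y'|
      ≤ ∑ y, |∑ y', A y * K y y' * B y'| := Finset.abs_sum_le_sum_abs _ _
    _ ≤ ∑ y, ∑ y', |A y * K y y' * B y'| := Finset.sum_le_sum fun y _ => Finset.abs_sum_le_sum_abs _ _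
    _ ≤ ∑ y, |A y| * (β₀ * b y) * κ := Finset.sum_le_sum fun y _ => hrow y
    _ ≤ ∑ y, α₀ * a y * (β₀ * b y) * κ :=
        Finset.sum_le_sum fun y _ => mul_le_mul_of_nonneg_right
          (mul_le_mul_of_nonneg_right (hA y) (mul_nonneg hβ (hb y))) hκ
    _ = α₀ * β₀ * κ * ∑ y, a y * b y := by
        rw [Finset.mul_sum]
        exact Finset.sum_congr rfl fun y _ => by ring
    _ ≤ α₀ * β₀ * κ * Λ := mul_le_mul_of_nonneg_left hpair (by positivity)

/-- **HYPOTHESIS SHAPE (v1.2) — the TWO-LEG inputs of (H1-par) at `U = 1`, componentwise part.**  With `a, b` the decay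
profiles of the two block-averaged free-gradient legs (dictionary: `a = (1+dist(z,·))⁻³`, `b = (1+dist(·,z′))⁻³`, (L91)
Thm. 1.5.5 (1.36) for far blocks and v1 §2 `blockSum_le_of_cubic` for the blocks adjacent to `z`, `z′`), `P(y,y′) =
(1+dist(y,y′))³` and `κ` a third row-moment of `K_eff` (finite uniformly in `k` for an exponentially localised kernel —
printed TYPE (K) Prop. 3.10 p. 669 / (B4) Lemma 2.4 p. 582; NOT asserted here):
* `legA`   `|(∇CQ*)(z,y)| ≤ α₀·a(y)`;   * `legB`  `|(QC∇′)(y,z′)| ≤ β₀·b(y)`;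
* `peetre` `b(y′) ≤ P(y,y′)·b(y)` (triangle inequality, `peetre_of_triangle` / `peetre_supNorm`);
* `moment` `Σ_{y′} |K_eff(y,y′)|·P(y,y′) ≤ κ`;
* `pair`   `Σ_y a(y)b(y) ≤ Λ` (`= 322` on `ℤ⁴`, `weightedPair_sum_le_of_embedding` with `(p,q) = (3,3)`).
NO `cancel`, NO Lipschitz/second-difference input, NO absolute row or block sum of a single factor. [folklore] -/
structure TwoLegInputs (gradCQ : Y → ℝ) (Keff : Y → Y → ℝ) (QCgrad : Y → ℝ) (a b : Y → ℝ) (P : Y → Y → ℝ)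
    (α₀ β₀ κ Λ : ℝ) : Prop where
  α_nonneg : 0 ≤ α₀
  β_nonneg : 0 ≤ β₀
  κ_nonneg : 0 ≤ κ
  b_nonneg : ∀ y, 0 ≤ b y
  legA : ∀ y, |gradCQ y| ≤ α₀ * a y
  legB : ∀ y, |QCgrad y| ≤ β₀ * b y
  peetre : ∀ y y', b y' ≤ P y y' * b y
  moment : ∀ y, ∑ y', |Keff y y'| * P y y' ≤ κ
  pair : ∑ y, a y * b y ≤ Λ

/-- **(H1-par) AT `U = 1`, COMPONENTWISE PART — THE TWO-LEG ESTIMATE (v1.2).**  Under `TwoLegInputs`,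
`|(∇R∇′)(z,z′)| ≤ α₀ β₀ κ Λ` — bounded, with a constant free of the volume and of `k` once the four numbers are.
[folklore] -/
theorem parametrixRemainder_le_twoLeg {gradCQ : Y → ℝ} {Keff : Y → Y → ℝ} {QCgrad : Y → ℝ} {a b : Y → ℝ}
    {P : Y → Y → ℝ} {α₀ β₀ κ Λ : ℝ} (h : TwoLegInputs gradCQ Keff QCgrad a b P α₀ β₀ κ Λ) :
    |woodburyRemainder gradCQ Keff QCgrad| ≤ α₀ * β₀ * κ * Λ := by
  rw [woodburyRemainder, abs_neg]
  exact abs_sum_sum_mul_mul_le_twoLeg gradCQ Keff QCgrad a b P h.α_nonneg h.β_nonneg h.κ_nonneg h.b_nonneg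
    h.legA h.legB h.peetre h.moment h.pair

/-- The two-leg bound for a FAMILY indexed by the scale `k` (sites, kernels, profiles depending on `k`; the four
constants NOT): `|(∇R∇′)| ≤ α₀ β₀ κ Λ` for every `k`. [folklore] -/
theorem parametrixRemainder_le_twoLeg_uniform {Yk : ℕ → Type*} [∀ k, Fintype (Yk k)]
    {gradCQ : ∀ k, Yk k → ℝ} {Keff : ∀ k, Yk k → Yk k → ℝ} {QCgrad : ∀ k, Yk k → ℝ}
    {a b : ∀ k, Yk k → ℝ} {P : ∀ k, Yk k → Yk k → ℝ} {α₀ β₀ κ Λ : ℝ}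
    (h : ∀ k, TwoLegInputs (gradCQ k) (Keff k) (QCgrad k) (a k) (b k) (P k) α₀ β₀ κ Λ) (k : ℕ) :
    |woodburyRemainder (gradCQ k) (Keff k) (QCgrad k)| ≤ α₀ * β₀ * κ * Λ :=
  parametrixRemainder_le_twoLeg (h k)

end TwoLeg

/-! ### The `ℤ⁴` dictionary instance: triangle inequality for `supNorm`, Peetre, and the packaged bound `≤ 322·α₀β₀κ` -/

section SupNormTwoLeg

variable {Y : Type*} [Fintype Y]

/-- Coordinates are bounded by the sup-norm. [folklore] -/
theorem natAbs_apply_le_supNorm {d : ℕ} (x : Fin d → ℤ) (i : Fin d) : (x i).natAbs ≤ supNorm x :=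
  Finset.le_sup (f := fun i => (x i).natAbs) (Finset.mem_univ i)

/-- Triangle inequality for the sup-norm: `‖x − z‖_∞ ≤ ‖x − y‖_∞ + ‖y − z‖_∞`. [folklore] -/
theorem supNorm_sub_le (d : ℕ) (x y z : Fin d → ℤ) : supNorm (x - z) ≤ supNorm (x - y) + supNorm (y - z) := by
  apply Finset.sup_le
  intro i _
  have hsplit : (x - z) i = (x - y) i + (y - z) i := by simp only [Pi.sub_apply]; ring
  rw [hsplit]
  exact (Int.natAbs_add_le _ _).trans
    (Nat.add_le_add (natAbs_apply_le_supNorm (x - y) i) (natAbs_apply_le_supNorm (y - z) i))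

omit [Fintype Y] in
/-- **PEETRE ON `ℤ⁴` (any `d`).**  For unit sites `e : Y ↪ ℤᵈ` and a centre `z′`:
`(1+‖e y′ − z′‖_∞)^{−p} ≤ (1+‖e y − e y′‖_∞)^p · (1+‖e y − z′‖_∞)^{−p}` — the field `TwoLegInputs.peetre` with
`b = (1+dist(·,z′))^{−p}`, `P(y,y′) = (1+dist(y,y′))^p`. [folklore] -/
theorem peetre_supNorm {d : ℕ} (e : Y ↪ (Fin d → ℤ)) (z' : Fin d → ℤ) (y y' : Y) (p : ℕ) :
    (1 / (1 + (supNorm (e y' - z') : ℝ))) ^ p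
      ≤ (1 + (supNorm (e y - e y') : ℝ)) ^ p * (1 / (1 + (supNorm (e y - z') : ℝ))) ^ p := by
  have htri : (supNorm (e y - z') : ℝ) ≤ (supNorm (e y - e y') : ℝ) + (supNorm (e y' - z') : ℝ) := by
    exact_mod_cast supNorm_sub_le d (e y) (e y') z'
  have h := peetre_of_triangle (a := (supNorm (e y - e y') : ℝ)) (b := (supNorm (e y' - z') : ℝ))
    (c := (supNorm (e y - z') : ℝ)) (by positivity) (by positivity) (by positivity) htri p
  rw [div_pow, one_pow, div_pow, one_pow]
  exact h

/-- **THE PACKAGED `ℤ⁴` BOUND (v1.2): `|(∇R∇′)(z,z′)| ≤ 322·α₀β₀κ`, ANY FINITE SET OF UNIT SITES, ANY `z, z′`, ANY LEG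
PROFILES `p + q ≥ 5`.**  Inputs: `dist^{−p}` / `dist^{−q}` decay of the two block-averaged legs from their respective
endpoints (`(p,q) = (3,3)` for `∇R∇′`, `(3,2)` / `(2,3)` for `∇R` / `R∇′`; the undifferentiated `R` has `(2,2)`,
`p + q = 4 = d`, and is NOT covered — there the cancellation form §5 is what supplies the fifth power) and a `q`-th
row-moment `Σ_{y′}|K_eff(y,y′)|(1+‖e y − e y′‖_∞)^q ≤ κ` of the effective unit-lattice kernel.  Nothing else — NO
cancellation and NO single-leg block sum.  This is the instantiable form of the (AF-0-L) slot «`∇R`-type kernels bounded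
LOCALLY, η-uniformly and volume-free» at `U = 1`, componentwise. [folklore] -/
theorem parametrixRemainder_le_of_embedding (e : Y ↪ (Fin 4 → ℤ)) (z z' : Fin 4 → ℤ) {p q : ℕ} (hpq : 5 ≤ p + q)
    {gradCQ : Y → ℝ} {Keff : Y → Y → ℝ} {QCgrad : Y → ℝ} {α₀ β₀ κ : ℝ} (hα : 0 ≤ α₀) (hβ : 0 ≤ β₀) (hκ : 0 ≤ κ)
    (hA : ∀ y, |gradCQ y| ≤ α₀ * (1 / (1 + (supNorm (e y - z) : ℝ))) ^ p)
    (hB : ∀ y, |QCgrad y| ≤ β₀ * (1 / (1 + (supNorm (e y - z') : ℝ))) ^ q)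
    (hK : ∀ y, ∑ y', |Keff y y'| * (1 + (supNorm (e y - e y') : ℝ)) ^ q ≤ κ) :
    |woodburyRemainder gradCQ Keff QCgrad| ≤ α₀ * β₀ * κ * 322 :=
  parametrixRemainder_le_twoLeg
    { α_nonneg := hα
      β_nonneg := hβ
      κ_nonneg := hκ
      b_nonneg := fun y => by positivity
      legA := hA
      legB := hB
      peetre := fun y y' => peetre_supNorm e z' y y' q
      moment := hK
      pair := weightedPair_sum_le_of_embedding e z z' hpq }

end SupNormTwoLeg

namespace Witness

/-- NON-VACUITY OF `TwoLegInputs` on one site with all data `1`: remainder `|−1| ≤ 1`. [folklore] -/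
theorem twoLegInputs_nonvacuous :
    TwoLegInputs (fun _ : Unit => (1 : ℝ)) (fun _ _ => 1) (fun _ => 1) (fun _ => 1) (fun _ => 1) (fun _ _ => 1)
      1 1 1 1 where
  α_nonneg := by norm_num
  β_nonneg := by norm_num
  κ_nonneg := by norm_num
  b_nonneg := fun _ => by norm_num
  legA := fun _ => by norm_num
  legB := fun _ => by norm_num
  peetre := fun _ _ => by norm_num
  moment := fun _ => by simp
  pair := by simp

example : |woodburyRemainder (fun _ : Unit => (1 : ℝ)) (fun _ _ => 1) (fun _ => 1)| ≤ 1 * 1 * 1 * 1 :=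
  parametrixRemainder_le_twoLeg twoLegInputs_nonvacuous

/-- The packaged `ℤ⁴` bound is non-vacuous: one unit site at the origin, both centres at the origin, all data `1`
(`|−1| ≤ 322`). [folklore] -/
example : |woodburyRemainder (fun _ : Unit => (1 : ℝ)) (fun _ _ => 1) (fun _ => 1)| ≤ 1 * 1 * 1 * 322 :=
  parametrixRemainder_le_of_embedding (Function.Embedding.mk (fun _ : Unit => (0 : Fin 4 → ℤ)) fun _ _ _ => rfl) 0 0
    (p := 3) (q := 3) (by norm_num) (by norm_num) (by norm_num) (by norm_num) (fun _ => by simp [supNorm])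
    (fun _ => by simp [supNorm]) (fun _ => by simp [supNorm])

end Witness

end Literature.MathematicalPhysics.QuantumFieldTheory.Balaban1983to89.Beta.BulkParametrix
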